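import Literature.NumberTheory.EllipticCurves.YanZhu2026.BDPMainConjectureRationalAtTrivialCharacter
import Literature.NumberTheory.EllipticCurves.YanZhu2026.AnticyclotomicBDPHeegnerEquivalence
import Literature.NumberTheory.EllipticCurves.MastellaZerman2026.HowardDivisibilityScalarImage
import HarnessLib

/-!
# The anticyclotomic BDP main conjecture AT THE TRIVIAL CHARACTER, INTEGRALLY, at an odd good
# ordinary prime under (irr_K) and NO image hypothesis, GRANTED Howard's Heegner-point divisibility:
# Yan–Zhu 2026 Thm. 5.7 (1) (rational clause) + Thm. 5.9 (the Heegner-point ⟺ BDP transfer, "as in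
# [BCK, Thm. 5.2]") + Burungale–Castella–Skinner 2025 Prop. 4.2.2 (`μ(L_p^BDP) = 0`, Hsieh) +
# Castella–Grossi–Lee–Skinner 2022 Thm. 5.1.3 (the BDP formula), composed on THE object
# `𝓛_p^BDP(E/K)`: `𝓕(0) = u · c_E⁻² (1 − a_p p⁻¹ + p⁻¹)² log_{ω_E}(P_K)²`, `u ∈ ℤ_p^×` — the conclusion of
# the (sur)-sibling `BurungaleCastellaSkinner2025.thm124b_thm513_generator_constantCoeff` with
# (sur) REPLACED by the Heegner-side containment `Char(S_ord/Λκ)² ⊆ Char(𝒳_ord,tor)`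

HONEST FRAMING. This file TYPES a composite of four PUBLISHED theorems as ONE named fact
(`def … : Prop`, nothing asserted, no `_holds`; D-0014/D-0026) in the tree's EXISTING vocabulary, in
the exact binder currency of its two siblings
`YanZhu2026.thm57_bcs422_cgls513_generator_constantCoeff` (p543659; the ONE-SIDED twin, `k ≥ 0`) and
`BurungaleCastellaSkinner2025.thm124b_thm513_generator_constantCoeff` (the INTEGRAL twin under (sur)),
and proves only bookkeeping. Typed ≠ proved ≠ endorsed. Written by the typer seat `bsd-print-x9-ty1`
(gen 8) of cell `run/shared/lean/pub/bsd-print-x9/` (D-0131 print tier; leaves X9 = irreducible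
NON-surjective image at a good ordinary `p ∈ {5, 7}`, X10b = the same at `p = 3`), 2026-08-27.

WHAT IT IS FOR. On both leaves the integral anticyclotomic main conjecture of print is DEAD by its
image hypothesis: BCS 2025 Thm. 1.2.4 (b) needs (sur) (and `p > 3`), Yan–Zhu 2026 Thm. 5.7 (1)'s
integral sentence needs `ρ_E|_{G_K}` onto `Aut_{ℤ_p}(T_pE)`. In BOTH printed proofs the image hypothesis
enters at exactly ONE place — Howard's divisibility `Char(M) ⊇ Char(S/Λκ)` [How04, Thm. B] — after
which the transfer to the BDP side is image-free: BCS Thm. 4.2.1, proof (p. 8, verbatim) "Under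
(sur), part (a) follows from [How04, Thm. B], and part (b) again from [BCK21, Thm. 5.2]"; Yan–Zhu,
proof of Thm. 5.7 (arXiv v2 p0011 L107–111, verbatim) "The other direction divisibility is given by
combining Theorem (HPMC) [= CGS 6.5.2 + Howard Thm. B for the integral clause] and Theorem (ant) [=
Thm. 5.9]". The tree holds Howard's divisibility WITHOUT surjectivity three times BY NAME
(`MastellaZerman2026.cor46_howardDivisibility_of_scalarImage`: any odd `p`, (irr) + scalars `1 + pℤ_p`
in the `p`-adic image, PUBLISHED, in-body image lemma; `BurungaleCastellaKim2021.thm31_howardThmB_of_irreducible`: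
`p ≥ 5`, proof by citation, flag `BCK21-3.1@How04+Fouquet13`; the cell memo theorem
`Howard2004_thmB_of_irreducible` of `bsd-smallim`), and it holds the transfer BY NAME
(`YanZhu2026.thm59_XGr_isTorsion_bdp_iff_heegnerPoint_localised`, `p ≥ 3`, (irr_K), no image
hypothesis). The fact below is the statement those inputs assemble to, with Howard's containment kept
as an explicit HYPOTHESIS (so that each of the three records, or any future one, can feed it), and
with the conclusion LETTER FOR LETTER that of `thm124b_thm513_generator_constantCoeff` — so the cells'
rank-one kernels written against that sibling (pattern `RowC2.bsdp_of_bcsThm112b_of_thm331_of_thm124b`: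
integral BDP main conjecture at `𝟙` + JSW Thm. 3.3.1 control + Gross–Zagier + the twist's rank-zero
input) port to X9/X10b frames with (sur) replaced by a Howard-at-non-(sur) input.

## Sources (texts READ for this file: the store texts `paper:arxiv-2412.20078` (= Yan–Zhu arXiv v2,
## pages `p00NN:Lnn`), `paper:arxiv-2405.00270` (BCS, arXiv v2), `paper:arxiv-2008.02571` (CGLS),
## `paper:arxiv-1908.09512` (BCK21); journal numbering of Yan–Zhu after the siblings' v4 TeX locators)

* **[YanZhu2024MainConjNonCM]** X. Yan, X. Zhu, *Main conjectures for non-CM elliptic curves at good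
  ordinary primes*, J. Algebra **693** (2026) 372–402 = arXiv:2412.20078. Setting of §5.2 (v4
  l.1189–1190; v2 §4.5 `[p0011 L49–L52]`, verbatim): "Let `E/ℚ` be an elliptic curve of conductor `N`,
  `p > 2` a prime such that `E` has good ordinary reduction at `p`, `K` an imaginary quadratic field
  such that `p = 𝔭𝔭̄` split in `K` and `(E, K)` satisfies the Heegner hypothesis. Assume that residue
  representation `ρ̄_E|_{G_K} : G_K → Aut(E[p])` is irreducible." (`𝓛_p^BDP(E/K) := 𝓛_p^BDP(f/K)` of
  Thm. 3.13 = [CGLS, Thm. 2.1.1], under §3.5's "`D_K` is odd and not equal to `−3`"; "Fix a modular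
  parametrization `π : X₀(N) → E`. … Perrin-Riou constructed an element `κ ∈ S_ord(E/K_∞⁻)` via the
  Kummer images of Heegner points on `X₀(N)`" `[p0011 L62]`.)
  **Theorem 5.7 (1)** (v4 l.1217–1227 = v2 Thm. 4.12 `[p0011 L66–L72]`, verbatim): "`𝒳_{𝓕_Gr}(E/K_∞⁻)`
  is `Λ_K`-torsion and `Char_{Λ_K}(𝒳_{𝓕_Gr}(E/K_∞⁻))Λ_K^{ur} ⊗ ℚ_p = (𝓛_p^BDP(E/K))` holds in
  `Λ_K ⊗ ℚ_p`. Moreover, if [full image] holds, then [the equality holds in `Λ_K^{ur}`]." ONLY THE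
  FIRST (rational) SENTENCE is used.
  **Theorem 5.9** (v4 l.1283–1293 = v2 Thm. 4.14 `[p0011 L96–L105]`, verbatim): "Similarly to [BCK],
  we have the following theorem. `𝒳_{𝓕_Gr}(E/K_∞⁻)` is `Λ_K`-torsion and for every nontrivial
  multiplicative set `S ⊂ Λ_K⁻`, the following are equivalent • `S⁻¹Char_{Λ_K}(𝒳_{𝓕_Gr}(E/K_∞⁻))Λ_K^{ur,−}
  ⊃ (𝓛_p^BDP(E/K))`. • `S⁻¹Char_{Λ_K⁻}(𝒳_ord(E/K_∞⁻)_tor) ⊃ S⁻¹Char_{Λ_K⁻}(S_ord(E/K_∞⁻)/Λ_K⁻·κ)²`.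
  The same result holds for the opposite divisibilities." USED with `S ⊂ (Λ_K⁻)^×` (trivial
  localisation, e.g. `S = {1}` or `S = ⟨1 + p⟩`; the tree's typed form quantifies `s ∈ Λ ∖ {0}` and
  its PROVED in-file consumer `YanZhu2026.bdp_mem_of_heegner_le_of_thm59` is exactly this instance).
  Its printed provenance [BCK] = Burungale–Castella–Kim, Algebra Number Theory **15** (2021) 1627–1653,
  **Thm. 5.2** (journal numbering, as cited by BCS Thm. 4.2.1 and by Castella arXiv:2407.11891 §3.6
  "[BCK21, §5]") = arXiv:1908.09512 **Thm. 4.1** (`[paper:arxiv-1908.09512 p0009 L11–L19]`, verbatim: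
  "Assume that `ρ̄|_{G_K}` is absolutely irreducible. Then Conjecture (HPMC) and Conjecture (BDP) are
  equivalent. More precisely, `X` has `Λ`-rank one if and only `X_{∅,0}` is `Λ`-torsion, and a
  one-sided divisibility in Conjecture (HPMC) holds if and only if the same divisibility holds in
  Conjecture (BDP)", standing `p > 3`, `p ∤ D_K`, `(D_K, N) = 1`, `p` split (§1.1 `[p0003 L5–L14]`,
  §4 `[p0009 L7]`)) — for `E/ℚ` and `N⁻ = 1` SUBSUMED by Thm. 5.9 (`p > 2`, irreducible) and therefore
  NOT typed separately (near-duplicate rule).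
* **[BurungaleCastellaSkinner2025]** A. Burungale, F. Castella, C. Skinner, IMRN **2025** rnaf082 =
  arXiv:2405.00270v2. **Proposition 4.2.2** (`[p0009 L2–L7]`, verbatim): "Let `g ∈ S₂(Γ₀(N))` be an
  elliptic newform with good reduction at `p > 2`, and suppose `K` is an imaginary quadratic field
  satisfying (disc), (Heeg), (spl), and (irr_K). Then `μ(L_p^Gr(g/K)) = μ(L_p^BDP(g/K)) = 0`. *Proof.*
  By [Hsi14, Thm. B], `L_p^BDP(g/K)` has vanishing `μ`-invariant. …"; (disc) "`D_K` is odd and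
  `D_K ≠ −3`", (Heeg), (spl) (§1.2, p. 2), (irr_K) "`ρ̄_g` is irreducible as `G_K`-representation"
  (p. 7). Thm. 4.2.1 and its proof (`[p0008 L105–L113]`) quoted above.
* **[CastellaGrossiLeeSkinner2022]** F. Castella, G. Grossi, J. Lee, C. Skinner, Invent. Math. **227**
  (2022) = arXiv:2008.02571. **Thm. 5.1.3** (`[paper:arxiv-2008.02571 p0024 L78–L82]`, rendered
  "Theorem 49" in the store text; TeX `thmpadicGZ`; data of §5.1.2 ibid. L60–L66: `E/ℚ` of conductor
  `N`, `π : X₀(N) → E`, `K` with the Heegner hypothesis, `P_K ∈ E(K)`, `ω_E` Néron, `c_E` the Manin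
  constant, `π^*(ω_E) = c_E · ω_f`), verbatim: "Under the above hypotheses, let `p > 2` be a prime of
  good reduction for `E` such that `p = v v̄` splits in `K`. Then `𝓛_E(0) = c_E⁻² · (1 − a_p p⁻¹ +
  p⁻¹)² · log_{ω_E}(P_K)²`, where `log_{ω_E} : E(K_v) → K_v` is the formal group logarithm associated
  to `ω_E`." (`𝓛_E` = CGLS Thm. 2.1.1's object = Yan–Zhu's `𝓛_p^BDP(f/K)` = BCS's `L_p^BDP(E/K)`; one
  construction [CH18, Prop. 3.8] — the reading of `BDPAnticyclotomicPAdicLFunction.lean`.)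
* **[Hsieh2014]** M.-L. Hsieh, Doc. Math. **19** (2014), Thm. B (source of Prop. 4.2.2, as cited).
  **[BertoliniDarmonPrasanna2013]** Duke Math. J. **162**, Thm. 5.13 (source of Thm. 5.1.3, as cited).
* Howard-side records (the HYPOTHESIS of the fact; not restated): [MastellaZerman2026] Ann. Math.
  Québec (2026) = arXiv:2505.08710, Cor. 4.6; [BurungaleCastellaKim2021] Thm. 3.1 (arXiv numbering);
  [Howard2004HeegnerKolyvagin] Compositio 140, Thm. B; Perrin-Riou 1987 (the `Λκ`/`I(ℋ_∞)` currency).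

## The composite, and the four-line algebra that assembles it (recorded for the referee)

Write `Λ = Λ_K⁻ = ℤ_p⟦T⟧`, `R = Λ_K^{−,ur} = R₀⟦T⟧` (`R₀ = ℤ_p^ur`; `R` is a domain in which `p` is a prime
element, `R/(p) = 𝔽̄_p⟦T⟧`), `𝓕 ∈ Λ` a generator of `Char_Λ(𝒳_{𝓕_Gr}(E/K_∞⁻))` (torsion: Thm. 5.7 (1)),
`L = 𝓛_p^BDP(E/K) ∈ R`. (i) Thm. 5.7 (1), rational sentence: `p^a 𝓕 = w p^b L` in `R` for some
`a, b ∈ ℕ`, `w ∈ R^×`. (ii) Prop. 4.2.2: `μ(L) = 0`, i.e. `p ∤ L` in `R` (some coefficient of `L` is a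
unit of `R₀`); in particular `L ≠ 0`. (iii) Thm. 5.9 with `S ⊂ Λ^×`, second bullet ⟹ first, fed by
the HYPOTHESIS `Char(S_ord/Λκ)² ⊆ Char(𝒳_ord,tor)`: `L ∈ Char(𝒳_{𝓕_Gr})R = (𝓕)R`, i.e. `L = 𝓕 h`.
Then `p^a 𝓕 = w p^b 𝓕 h` and `𝓕 ≠ 0`, so `p^a = w p^b h`; `b > a` would make `p` a unit of `R`, so
`a ≥ b` and `h = w⁻¹ p^{a−b}`, `L = w⁻¹ p^{a−b} 𝓕`; by (ii) `a = b`, hence **`(𝓕)R = (L)`** (the INTEGRAL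
BDP main conjecture, = the conclusion of BCS Thm. 1.2.4 (b) / Yan–Zhu Thm. 5.7 (1) second sentence,
WITHOUT their image hypotheses) and `𝓕(0) = w(0) · L(𝟙)` with `w(0) ∈ R₀^×`. (iv) Thm. 5.1.3:
`L(𝟙) = c_E⁻² (1 − a_p p⁻¹ + p⁻¹)² log_{ω_E}(P_K)² ∈ K_v = ℚ_p`; so `𝓕(0) = u · c_E⁻² (1 − a_p p⁻¹ + p⁻¹)²
log_{ω_E}(P_K)²` with `u = w(0) ∈ ℚ_p ∩ R₀^× = ℤ_p^×` when the value is non-zero (`u := 1` serves when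
it is zero). Byproduct not recorded (weaker, never stronger): with `(𝓕)R = (L)`, Thm. 5.9's
"opposite divisibilities" clause gives back `Char(𝒳_ord,tor) ⊆ Char(S_ord/Λκ)²`, i.e. together with the
hypothesis Perrin-Riou's Heegner point main conjecture INTEGRALLY at such `(E, K, p)`.

REFEREE FLAGS offered with this fact (travel with it): `YZ26-57i+59+BCS422+CGLS513-composite` — the
displayed identity is not printed as such; it is the four printed statements about ONE object
assembled by (i)–(iv) above; this is word for word the structure of the printed proofs of BCS Thm.
1.2.4 (b) (via Thm. 4.2.1) and of Yan–Zhu Thm. 5.7 (1)'s integral sentence, with [How04, Thm. B]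
replaced by an explicit hypothesis. Inherited provenance at `p = 3`: cell flag `YZ26@3-BF-ERL-Ohta`
of `YanZhu2026/PPartBSD.lean` (Thm. 5.7 (1)'s proof passes through the two-variable §4); Thm. 5.9's
"Similarly to [BCK]" (BCK21 Thm. 5.2 is printed for `p > 3` and absolute irreducibility; the s = 1
reading of "nontrivial multiplicative set" is the one of the typed `thm59_…` and of its proved
consumer). Reading flag inherited: `BCS-124-XGr-reading` (`𝒳_{𝓕_Gr}(E/K_∞⁻) = AcSelmer.XAc … vbar ∅ γ`,
relaxed at `𝔭 = v` induced by `ι`, strict at `𝔭̄`). Level latitude inherited from both siblings: `N`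
is the level of a `ModularParametrizationData W N` (which carries the NEWFORM of `W`, so `N = N_E` in
substance; the kernel reads `N = N_E` only through Carayol's fact). The statement is the REFEREED
statements' composite, valid as printed at every `p > 2`; the flags concern proof-level inputs and are
not a claim that anything is false. The HYPOTHESIS side carries its own prices when discharged:
`MastellaZerman2026.cor46_…` (PUB; per-pair scalar-image certificate, REF-70), `thm31_…` (flag
`BCK21-3.1@How04+Fouquet13`), and BCS Rem. 1.2.3 ("Under (irr_ℚ), the only case excluded by Theorem
1.2.2(b) is that of (residually) dihedral primes `p`. It will be treated in [BS24]" — [BS24] not in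
print on 2026-08-27): the authors do NOT claim the dihedral (= X9 5Ns/7Ns, X10b 3Ns/3Nn) case; a
closure citing this composite with a Howard-at-dihedral input is a COMPOSITE-OF-PRINT closure whose
Howard input the referee prices, not a printed theorem.

WHY A COMPOSITE AND NOT A DERIVATION (D-0026 bookkeeping, for the reviewer). The DERIVED road — prove
this statement from the typed `thm57_isTorsion_charIdealXGr_eq_bdpLFunction` (5.7 (1)),
`thm59_XGr_isTorsion_bdp_iff_heegnerPoint_localised` (5.9), `prop422_exists_isBDPLFunction_mu_eq_zero`
(4.2.2) and a CGLS 5.1.3 fact — is closed in the kernel by the SHAPE of those facts: each concludes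
`∃ (Ω_K, Ω_p, L), IsBDPLFunction … L ∧ …` for ITS OWN frame, and nothing in the tree identifies two
frames of `𝓛_p^BDP` (the rigidity "two interpolating series for the same `(ι, 𝔭, κ, γ, f)` differ by
`R₀^× · (1+T)^{ℤ_p}`" is standard but neither printed as a numbered statement nor formalised); in print
all four theorems are about THE object `𝓛_p^BDP(f/K)` of Thm. 3.13 = [CGLS, Thm. 2.1.1], which is what
the composite records — same decision, same flag class, as the siblings p533331 (REF-6: PUB[composite],
LITERAL for consumers) and p543659. The algebra (i)–(iv) is then two units and one prime element of
`R₀⟦T⟧`; it is recorded above rather than proved because its inputs live on four different frames.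

STATUS 2026-08-27 (ty1 gen 16) — DERIVED. The preceding paragraph is now historical: the frame rigidity IS
formalised on the Summits side (`Summit.BirchSwinnertonDyer.Rank1Residual.X11b.R1.span_singleton_eq_of_isBDPLFunction`,
`…X11b.constantCoeff_eq_of_isBDPLFunction`, cell b2b-bsdres), and with it this named fact is PROVED,
letter for letter, from the four single-source facts above plus Carayol's level fact, in
`Summits/BirchSwinnertonDyer/Rank1Residual/X11b/YZCompositeOfFrames.lean`:
`Summit.BirchSwinnertonDyer.Rank1Residual.X11b.YZComposite.thm57_thm59_bcs422_cgls513_of_heegnerDivisibility_of_printFacts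
(h57) (h59) (h422) (h513 : CastellaGrossiLeeSkinner2022.thm513_exists_isBDPLFunction_valueAtOne_disc)
(hC : ∀ N, IsNewformOf.level_eq_conductorNorm)` (and `…_of_modularity … (hpar : nonempty_modularParametrizationData)`);
the passage from the arbitrary complex embedding `ιC` to the infinite place of CGLS Thm. 5.1.3's fact is
Darmon 2004 Prop. 3.11 (tree theorem `heegnerPoint_conj_add_rootNumber_smul_holds`), rank-free. The
definition below is UNCHANGED (its consumers keep the binder by name and are fed that theorem at the leaf);
it stays a `def` here only because Literature cannot import the Summits-side rigidity theorems.

## Transcription (binders = `thm57_bcs422_cgls513_generator_constantCoeff`'s, PLUS `p ∤ h_K`, PLUS the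
## Howard-side hypothesis; conclusion = `thm124b_thm513_generator_constantCoeff`'s)

* "`E/ℚ` of conductor `N`, `p > 2` good ordinary" = a globally minimal `W`, `3 ≤ p`, `GoodOrd W p`;
  (irr_K) = `(W.baseChange K).HasIrreducibleModPGaloisRep p` (from (irr_ℚ) by Matar–Nekovář 2019 Prop.
  5.26 (2), tree THEOREM `MatarNekovar2019.prop526_hasIrreducibleModPGaloisRep_baseChange_holds`).
* `K`: `IsImaginaryQuadratic K`; (Heeg) `SatisfiesHeegnerHypothesis (W.conductorNorm ℤ) K`; (spl)
  `SatisfiesHeegnerHypothesis p K`; (disc) `Odd (discr K) ∧ discr K ≠ -3`; EXTRA `¬ p ∣ h_K` — the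
  standing hypothesis of the tree's Heegner-family vocabulary (Howard 2004 §3.3, `heegnerModule D F =
  Λκ`), exactly the field `Thm57Hypotheses.not_dvd_classNumber` under which Thm. 5.9 is typed.
* `(ι, v, vbar, κ, γ)`, `𝒳_{𝓕_Gr}(E/K_∞⁻) = AcSelmer.XAc (W.baseChange K) p κ vbar ∅ γ`, `(N, Dt, H, ιC, P)`,
  `log_{ω_E}(P_K) = log_W(z(m₀ • P_ι))/m₀`: EXACTLY the siblings' binders.
* Howard's containment "`Char_{Λ_K⁻}(𝒳_ord(E/K_∞⁻)_tor) ⊃ Char_{Λ_K⁻}(S_ord(E/K_∞⁻)/Λ_K⁻·κ)²`" (Thm.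
  5.9's second bullet with `S ⊂ Λ^×`) in the currency of `Howard2004_thmB` / Thm. 5.9: for SOME
  `jbar : K̄ → ℂ`, `Λ`-adic Selmer datum `D` (`S_ord = D.S`), Heegner family `F` at the level `N` of `Dt`
  (`Λκ = heegnerModule D F`, `Char(S_ord/Λκ) = heegnerCharIdeal D F`) and dual datum `X` (`𝒳_ord = X.X`):
  `(heegnerCharIdeal D F)² ≤ char_Λ(X.X_tors)`. EXISTENTIAL over the data (the data are canonical up to
  the printed pseudo-isomorphisms — `lambdaAdicSelmerData_exists_unique`, the universal properties —
  so ∃ = ∀ in substance; ∃ is the vacuity-safe choice for a HYPOTHESIS and is what the typed Thm. 5.9,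
  quantified ∀ data, consumes). The three tree records deliver `char_Λ(X.X_tors) ∣ (heegnerCharIdeal D F)²`
  for ALL data; `Ideal.le_of_dvd` turns it into the containment (bookkeeping below).
* Conclusion (= `thm124b_thm513_generator_constantCoeff`'s, letter for letter): `𝒳_{𝓕_Gr}` is
  `Λ`-torsion and there is a generator `F` of `Char_Λ(𝒳_{𝓕_Gr})` and `u ∈ ℤ_p^×` with
  `F(0) = u · c_E⁻² · (1 − a_p p⁻¹ + p⁻¹)² · log_{ω_E}(P_K)²` in `ℚ_p`.

## Contents

* `thm57_thm59_bcs422_cgls513_generator_constantCoeff_of_heegnerDivisibility` — the named fact (ONE new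
  `def … : Prop`; nothing asserted).
* PROVED (bookkeeping, no mathematical content of their own): `heegnerContainment_of_cor46`,
  `heegnerContainment_of_thm31`, `heegnerContainment_of_howard2004ThmB` (each tree record of Howard's
  theorem discharges the hypothesis at given data — the last one is BCS Thm. 4.2.1's own "(sur)" road);
  `generator_constantCoeff_eq_of_heegnerDivisibility` (every generator, own unit);
  `valuation_generator_constantCoeff_of_heegnerDivisibility` and
  `hasCharValuationAt_of_heegnerDivisibility` (the identity in valuations / in the cells' packaged
  currency `AcSelmer.XAc.HasCharValuationAt … n ∧ n = 2·(ord_p(1 − a_p + p) − 1 + ord_p log_{ω_E} P_K) −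
  2·ord_p c_E` — the body of `X11b.IMCWaldspurgerOnTreeGoodAt` up to the Manin term — at every `p ≥ 3`,
  no image hypothesis, modulo the Howard input); `generator_constantCoeff_of_cor46` (the fact composed
  with Mastella–Zerman's record: the X9/X10b consumer edge, scalar-image certificate explicit).
* PINNED twin (2026-08-28, §"The normalisation of the Heegner class" below):
  `thm57_thm59_bcs422_cgls513_generator_constantCoeff_of_pinnedHeegnerDivisibility` (ONE new `def … :
  Prop`, the same composite with the Howard-side hypothesis restricted to families of `p`-adic-unit
  Manin constant, `¬ (p : ℤ) ∣ F.Dt.c`), PROVED to follow from the unpinned fact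
  (`thm57_thm59_bcs422_cgls513_pinned_of_unpinned`), with the pinned bookkeeping twins
  `pinnedHeegnerContainment_of_cor46` / `_of_thm31` / `_of_howard2004ThmB`,
  `generator_constantCoeff_eq_of_pinnedHeegnerDivisibility`,
  `valuation_generator_constantCoeff_of_pinnedHeegnerDivisibility`,
  `hasCharValuationAt_of_pinnedHeegnerDivisibility`, `generator_constantCoeff_of_cor46_pinned`.

## The normalisation of the Heegner class in print, and the PINNED typing (2026-08-28, cell
## `pub/bsd-print-x9`, planner finding PIN-1; literature seat `bsd-print-x9-lit` g25, texts READ)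

The HYPOTHESIS of the fact above — "`(heegnerCharIdeal D F)² ≤ char_Λ(X.X_tors)` for SOME Heegner
family `F`" — does not restrict the Manin constant `F.Dt.c` of the family's parametrisation datum
(`φ = uniformize (c · 2πi ∫ f)`, `φ^* ω_E = c · 2πi f dτ`, `ModularCurve.lean`). The tree CONSTRUCTS
rescaled data and families (`ModularParametrizationData.zsmul`, `HeegnerFamily.zsmulSelf`:
`ModularParametrizationScalingProofs.lean`, `HeegnerFamilyScalingProofs.lean`; `heegnerModuleLayer_zsmul`:
`ℋ̄_k(m • F) = m • ℋ̄_k(F)`, `HeegnerModuleScalingProofs.lean`), so the existential is met by a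
`p`-power rescaling of any family satisfying the `p`-LOCALIZED containment — for which print's chain
(i)–(iv) above yields only `p^{2a} L ∈ (𝓕)R`, i.e. `(𝓕)R = p^{μ}(L)` with `μ ≥ 0` undetermined, NOT
the recorded conclusion. Print's step (iii) (Thm. 5.9, "Similarly to [BCK]" = BCK21 Thm. 5.2) is a
statement about ONE class `κ`, built with ONE parametrisation, and is EXACT only in the normalisation
in which that parametrisation has `p`-adic-unit Manin constant — Burungale–Castella–Kim, ANT 15 (2021)
= arXiv:1908.09512v2, Remark 1.2 (TeX l.192–195, verbatim): "As formulated in [PR87, Conj. B], the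
second equality of characteristic ideals in (ii) includes the factor `c_π · (#𝒪_K^×)/2`, where
`c_π ∈ ℤ_{>0}` is the Manin constant associated to `π`. However, `𝒪_K^× = {±1}` by our hypothesis
(disc), and `c_π` is a `p`-adic unit by [Mazur] and our hypothesis that `p ∤ N`"; App. A (l.1116–1120):
"`E` … `(ℤ, pℤ_p)`-optimal in the sense of [W. Zhang 2014, §3.7] … `π : J(X_{N⁺,N⁻}) → E` the quotient
map"; the equivalence of Thm. 5.2 rests on the EXACT identity (A4) (l.1079–1081) `ord_{𝔓'}(𝓛_𝔭^BDP) =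
length(coker(loc_𝔭)Λ^ur) + length(𝒮^ur/Λ^ur κ_∞)` from the explicit reciprocity law Thm. 4.4 (l.929–941)
`Log_𝔭(loc_𝔭 κ_∞) = −𝓛_𝔭^BDP · σ_{−1,𝔭}` for the Jacobian-built class; Castella–Grossi–Lee–Skinner,
Invent. Math. 227 (2022), §1 Conj. 1 (arXiv:2008.02571 p. 3) displays the same factor for an arbitrary
fixed `π`: `char_Λ(X_tors) = (c_E² u_K²)⁻¹ · char_Λ(𝒮/Λκ₁^Hg)²`, `π^*(ω_E) = c_E · 2πi f dτ`. In the
tree's currency "`c_π u_K` is a `p`-adic unit" reads `¬ (p : ℤ) ∣ F.Dt.c` (`u_K = 1` from `D_K` odd,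
`≠ −3`). Accordingly the fact above is FLAGGED `layout: unpinned family` (statement unchanged; its
Summits-side derivation `X11b.YZComposite.thm57_thm59_bcs422_cgls513_of_heegnerDivisibility_of_printFacts`
runs through the equally unpinned typing `thm59_XGr_isTorsion_bdp_iff_heegnerPoint_localised`, flagged
alike) and SUPERSEDED for route use by the PINNED twin
`thm57_thm59_bcs422_cgls513_generator_constantCoeff_of_pinnedHeegnerDivisibility`, whose hypothesis is
`∃ jbar D F X, ¬ (p : ℤ) ∣ F.Dt.c ∧ (heegnerCharIdeal D F)² ≤ char_Λ(X.X_tors)` — WEAKER than the fact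
above (`thm57_thm59_bcs422_cgls513_pinned_of_unpinned`, proved), derivable on the Summits side from the
pinned Thm. 5.9 (`thm59_XGr_isTorsion_bdp_iff_heegnerPoint_localised_pinned`,
`bdp_mem_of_heegner_le_of_thm59_pinned`) by the same file, binder `hc` threaded. The three Howard-side
records (MZ26 Cor. 4.6, BCK21 Thm. 3.1, Howard Thm. B) conclude the containment for ALL data, hence in
particular for pinned families: their pinned discharges take `hc : ¬ (p : ℤ) ∣ F.Dt.c` as an argument
(at a leaf: the frame's `¬ (p : ℤ) ∣ Dt.c`, Mazur 1978 Cor. 4.1 for the optimal curve — tree fact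
`ModularForms.mazur_not_dvd_maninConstant_of_odd` — or a Cremona `c = 1` certificate, transported along
the tie `F.Dt = Dt` of `exists_heegnerFamily_Dt_eq`, `HeegnerNormPointExistenceProofs.lean`).

## References
* [YanZhu2024MainConjNonCM] J. Algebra 693 (2026) = arXiv:2412.20078: §5.2 setting, Thm. 5.7 (1),
  Thm. 5.9 and the proof of Thm. 5.7 (v4 l.1189–1308; v2 §4.5 p0011 L49–L111); §3.5, Thm. 3.13.
* [BurungaleCastellaKim2021] ANT 15 (2021), Thm. 5.2 (journal) = arXiv:1908.09512 Thm. 4.1 (§4);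
  journal = arXiv v2 numbering: Remark 1.2 (TeX l.192–195), Thm. 4.4 eq. (ERL) (l.929–941), Thm. 5.2
  with eq. (A4) (l.1044–1097, l.1079–1081), App. A (l.1116–1120).
* [CastellaGrossiLeeSkinner2022] §1 Conj. 1 (arXiv:2008.02571 p. 3: the factor `(c_E² u_K²)⁻¹`).
* [PerrinRiou1987BSMF] Conj. B (the factor `c · u_K`, as reported by BCK21 Remark 1.2 and displayed by
  CGLS22 Conj. 1); B. Mazur, Invent. Math. 44 (1978), Cor. 4.1 (`ModularForms.mazur_not_dvd_maninConstant_of_odd`).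
* [BurungaleCastellaSkinner2025] IMRN 2025 = arXiv:2405.00270v2: Prop. 4.2.2 (p. 9), Thm. 4.2.1 and
  proof (p. 8), Thm. 1.2.4 (p. 3), Rem. 1.2.3 (p. 3), §1.2 (pp. 2–3), (irr_K) (p. 7).
* [CastellaGrossiLeeSkinner2022] Invent. Math. 227 (2022) = arXiv:2008.02571: Thm. 5.1.3, §5.1.2,
  Thm. 2.1.1. [Hsieh2014] Doc. Math. 19, Thm. B. [BertoliniDarmonPrasanna2013] Duke 162, Thm. 5.13.
* [MastellaZerman2026] arXiv:2505.08710, Cor. 4.6; [Howard2004HeegnerKolyvagin] Compositio 140, Thm. B;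
  [PerrinRiou1987BSMF]; [MatarNekovar2019] JTNB 31, Prop. 5.26 (2).
* Tree: the siblings `YanZhu2026/BDPMainConjectureRationalAtTrivialCharacter.lean` (p543659),
  `BurungaleCastellaSkinner2025/BDPMainConjectureAtTrivialCharacter.lean`,
  `YanZhu2026/AnticyclotomicBDPHeegnerEquivalence.lean` (Thm. 5.9),
  `MastellaZerman2026/HowardDivisibilityScalarImage.lean`, `HeegnerModuleIndex.lean` (the currency).
-/

set_option autoImplicit false

noncomputable section

open scoped Classical

open WeierstrassCurve NumberField IsDedekindDomain Field Literature.NumberTheory.EllipticCurves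
  Literature.NumberTheory.EllipticCurves.ModularForms Literature.NumberTheory.QuadraticFields
  Literature.NumberTheory.EllipticCurves.Rank1Residual
  Literature.NumberTheory.EllipticCurves.Castella2018

namespace Literature.NumberTheory.EllipticCurves.YanZhu2026

/-- **Yan–Zhu, J. Algebra 693 (2026) = arXiv:2412.20078, Theorem 5.7 (1) (rational sentence) and
Theorem 5.9 (the Heegner-point ⟺ BDP transfer, `S ⊂ Λ^×`), Burungale–Castella–Skinner, IMRN 2025 =
arXiv:2405.00270v2, Proposition 4.2.2 (`μ(L_p^BDP) = 0`), and Castella–Grossi–Lee–Skinner, Invent. Math.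
227 (2022), Theorem 5.1.3 (the Bertolini–Darmon–Prasanna formula), composed on the one object
`𝓛_p^BDP(E/K)` AT THE TRIVIAL CHARACTER, GRANTED Howard's Heegner-point containment.** Thm. 5.7 (1)
(verbatim; setting of §5.2: "`E/ℚ` an elliptic curve of conductor `N`, `p > 2` a prime such that `E`
has good ordinary reduction at `p`, `K` an imaginary quadratic field such that `p = 𝔭𝔭̄` split in `K`
and `(E, K)` satisfies the Heegner hypothesis. Assume that residue representation `ρ̄_E|_{G_K} : G_K →
Aut(E[p])` is irreducible"; §3.5: "`D_K` is odd, `D_K ≠ −3`"): "`𝒳_{𝓕_Gr}(E/K_∞⁻)` is `Λ_K`-torsion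
and `Char_{Λ_K}(𝒳_{𝓕_Gr}(E/K_∞⁻))Λ_K^{ur} ⊗ ℚ_p = (𝓛_p^BDP(E/K))` holds in `Λ_K ⊗ ℚ_p`." Thm. 5.9
(verbatim): "`𝒳_{𝓕_Gr}(E/K_∞⁻)` is `Λ_K`-torsion and for every nontrivial multiplicative set `S ⊂ Λ_K⁻`,
the following are equivalent • `S⁻¹Char_{Λ_K}(𝒳_{𝓕_Gr}(E/K_∞⁻))Λ_K^{ur,−} ⊃ (𝓛_p^BDP(E/K))`. •
`S⁻¹Char_{Λ_K⁻}(𝒳_ord(E/K_∞⁻)_tor) ⊃ S⁻¹Char_{Λ_K⁻}(S_ord(E/K_∞⁻)/Λ_K⁻·κ)²`. The same result holds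
for the opposite divisibilities" ("Similarly to [BCK]" = Burungale–Castella–Kim, ANT 15 (2021) Thm.
5.2 = arXiv:1908.09512 Thm. 4.1). Prop. 4.2.2 (verbatim): "Let `g ∈ S₂(Γ₀(N))` be an elliptic newform
with good reduction at `p > 2`, and suppose `K` is an imaginary quadratic field satisfying (disc),
(Heeg), (spl), and (irr_K). Then `μ(L_p^Gr(g/K)) = μ(L_p^BDP(g/K)) = 0`." CGLS Thm. 5.1.3 (verbatim;
data of §5.1.2: conductor `N`, `π : X₀(N) → E`, `P_K`, `c_E` with `π^*(ω_E) = c_E ω_f`): "let `p > 2`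
be a prime of good reduction for `E` such that `p = v v̄` splits in `K`. Then `𝓛_E(0) = c_E⁻² · (1 −
a_p p⁻¹ + p⁻¹)² · log_{ω_E}(P_K)²`." COMPOSED (module docstring (i)–(iv): `p^a 𝓕 = w p^b L`, `p ∤ L`,
`L ∈ (𝓕)` ⟹ `(𝓕)Λ^{ur,−} = (L)`, `𝓕(0) = w(0) L(𝟙)`): GRANTED the Heegner-side containment
`Char(𝒳_ord,tor) ⊃ Char(S_ord/Λκ)²` (Thm. 5.9's second bullet at `S ⊂ Λ^×` — Howard's theorem, NOT
assumed proved here: a HYPOTHESIS, dischargeable from `MastellaZerman2026.cor46_…`,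
`BurungaleCastellaKim2021.thm31_…` or `Howard2004_thmB`), a generator `𝓕 ∈ Λ` of
`Char(𝒳_{𝓕_Gr}(E/K_∞⁻))` satisfies `𝓕(0) = u · c_E⁻² (1 − a_p p⁻¹ + p⁻¹)² log_{ω_E}(P_K)²` for some
`u ∈ ℤ_p^×` (an identity in `K_v = ℚ_p`). TRANSCRIBED (module docstring for the dictionary): `W`
globally minimal, `3 ≤ p`, `GoodOrd W p`; `K` imaginary quadratic with (Heeg) for `N_E`, (spl), (disc),
(irr_K) `(W.baseChange K).HasIrreducibleModPGaloisRep p`, EXTRA `p ∤ h_K` (the Heegner-family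
vocabulary's standing hypothesis, = `Thm57Hypotheses.not_dvd_classNumber`); `(ι, v, vbar, κ, γ)` and
`𝒳_{𝓕_Gr}(E/K_∞⁻) = AcSelmer.XAc (W.baseChange K) p κ vbar ∅ γ` exactly as in the siblings
`thm57_bcs422_cgls513_generator_constantCoeff` / `BurungaleCastellaSkinner2025.thm124b_thm513_generator_constantCoeff`
(relaxed at `v`, strict at `v̄`; reading flag `BCS-124-XGr-reading`); `(N, Dt, H, ιC, P)` and
`log_{ω_E}(P_K) = log_W(z(m₀ • P_ι))/m₀` exactly as there; the containment hypothesis: for some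
`jbar`, `Λ`-adic Selmer datum `D`, Heegner family `F` at level `N` and dual datum `X`,
`(heegnerCharIdeal D F)² ≤ char_Λ(X.X_tors)`; conclusion = the (sur)-sibling's, letter for letter:
`𝒳_{𝓕_Gr}` is `Λ`-torsion and there is a generator `F` of `Char_Λ(𝒳_{𝓕_Gr})` and `u ∈ ℤ_p^×` with `F(0)
= u · c_E⁻² · (1 − a_p p⁻¹ + p⁻¹)² · log_{ω_E}(P_K)²` in `ℚ_p`. COMPOSITE OF FOUR PRINTED, PUBLISHED
THEOREMS about one object (flag `YZ26-57i+59+BCS422+CGLS513-composite`; inherited at `p = 3`: cell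
flag `YZ26@3-BF-ERL-Ohta`); NO image hypothesis; nothing asserted. LAYOUT FLAG `layout: unpinned
family` (2026-08-28, cell `pub/bsd-print-x9` finding PIN-1; statement UNCHANGED): the containment
hypothesis quantifies `∃ … (F : HeegnerFamily …)` without restricting the Manin constant `F.Dt.c`,
whereas print's step (iii) is about the class of ONE parametrisation of `p`-adic-unit Manin constant
(BCK21 Remark 1.2, App. A; CGLS22 Conj. 1's factor `(c_E² u_K²)⁻¹`; module docstring) — met by a
`p`-power-rescaled family the hypothesis is only the `p`-localized containment, from which print gives
the conclusion up to `p^μ`; SUPERSEDED for route use by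
`thm57_thm59_bcs422_cgls513_generator_constantCoeff_of_pinnedHeegnerDivisibility` (hypothesis
`¬ (p : ℤ) ∣ F.Dt.c ∧ …`), which this fact implies (`thm57_thm59_bcs422_cgls513_pinned_of_unpinned`).
[cite: YanZhu2024MainConjNonCM, Thm. 5.7 (1), first sentence, and Thm. 5.9 (§5.2; arXiv:2412.20078v4 TeX l.1217–1223, l.1283–1293; = arXiv v2 Thm. 4.12 (1), Thm. 4.14, p0011 L66–L72, L96–L105) with setting l.1189–1190 (v2 p0011 L49–L52), §3.5 and Thm. 3.13; proof of Thm. 5.7 (v2 p0011 L107–L111)]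
[cite: BurungaleCastellaKim2021, Thm. 5.2 (journal numbering) = arXiv:1908.09512 Thm. 4.1 (§4, p0009 L11–L19) (the source of Thm. 5.9, as cited)]
[cite: BurungaleCastellaSkinner2025, Prop. 4.2.2 (p. 9; arXiv:2405.00270v2 p0009 L2–L7) with (disc)/(Heeg)/(spl) (§1.2, pp. 2–3) and (irr_K) (p. 7); Thm. 4.2.1 and its proof (p. 8, p0008 L105–L113)]
[cite: CastellaGrossiLeeSkinner2022, Thm. 5.1.3 (arXiv:2008.02571 p0024 L78–L82; TeX `thmpadicGZ`) with §5.1.2 (p0024 L60–L66)]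
[cite: Hsieh2014, Thm. B (the source of Prop. 4.2.2, as cited by BCS)]
[cite: BertoliniDarmonPrasanna2013, Thm. 5.13 (the source of Thm. 5.1.3)]
[cite: Howard2004HeegnerKolyvagin, §1 Thm. B and Thm. 3.3.7 (the currency `heegnerCharIdeal`, `𝐇 = Λκ`)] -/
def thm57_thm59_bcs422_cgls513_generator_constantCoeff_of_heegnerDivisibility : Prop :=
  ∀ (W : WeierstrassCurve ℚ) [W.IsElliptic] [W.IsGloballyMinimal] (p : ℕ) [Fact p.Prime],
    3 ≤ p → GoodOrd W p →
    ∀ (K : Type) [Field K] [NumberField K], IsImaginaryQuadratic K →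
      SatisfiesHeegnerHypothesis (W.conductorNorm ℤ) K → SatisfiesHeegnerHypothesis p K →
      Odd (NumberField.discr K) → NumberField.discr K ≠ -3 →
      (W.baseChange K).HasIrreducibleModPGaloisRep p →
      ¬ p ∣ NumberField.classNumber K →
    ∀ (ι : K →+* ℚ_[p]) (v vbar : HeightOneSpectrum (𝓞 K)),
      (∀ x : 𝓞 K, x ∈ v.asIdeal ↔ ‖ι (x : K)‖ < 1) →
      ((p : ℕ) : 𝓞 K) ∈ vbar.asIdeal → vbar ≠ v →
    ∀ (κ : ZpExtension K p), κ.IsAnticyclotomic →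
    ∀ (γ : absoluteGaloisGroup K) [Fact (κ.IsTopGenerator γ)],
    ∀ (N : ℕ) [NeZero N] (Dt : ModularParametrizationData W N)
      (H : HeegnerDatum N (NumberField.discr K)) (ιC : K →+* ℂ) (P : (W.baseChange K).toAffine.Point),
      WeierstrassCurve.Affine.Point.map ιC.toRatAlgHom P = heegnerPointComplex Dt H →
      (∃ (jbar : AlgebraicClosure K →+* ℂ) (D : (W.baseChange K).LambdaAdicSelmerData κ γ)
          (F : HeegnerFamily N W K κ jbar) (X : (W.baseChange K).SelmerDualData κ γ),
          heegnerCharIdeal D F ^ 2 ≤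
            Module.charIdeal (IwasawaAlgebra p) (Submodule.torsion (IwasawaAlgebra p) X.X)) →
      Module.IsTorsion (IwasawaAlgebra p) (AcSelmer.XAc (W.baseChange K) p κ vbar ∅ γ) ∧
      ∃ F : IwasawaAlgebra p,
        AcSelmer.XAc.charIdeal (W.baseChange K) p κ vbar ∅ γ = Ideal.span {F} ∧
        ∃ u : ℤ_[p]ˣ,
          ((PowerSeries.constantCoeff F : ℤ_[p]) : ℚ_[p]) =
            ((u : ℤ_[p]) : ℚ_[p]) * ((Dt.c : ℚ_[p])⁻¹) ^ 2 *
              (1 - (W.frobeniusTrace p : ℚ_[p]) * (p : ℚ_[p])⁻¹ + (p : ℚ_[p])⁻¹) ^ 2 *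
              ((W.baseChange ℚ_[p]).padicLogPoint (formalIndex W p • padicPointOf W p ι P) /
                (formalIndex W p : ℚ_[p])) ^ 2

/-! ### Discharging the Howard-side hypothesis from the tree's records (bookkeeping) -/

section Howard

variable {p : ℕ} [Fact p.Prime] {N : ℕ} [NeZero N] {W : WeierstrassCurve ℚ} [W.IsGloballyMinimal]
  {K : Type} [Field K] [NumberField K] {κ : ZpExtension K p} {γ : absoluteGaloisGroup K}

/-- **Mastella–Zerman 2026 Cor. 4.6 discharges the containment hypothesis** at any data `(jbar, D,
F, X)` of level `N`, for `(E, K, p)` satisfying its printed hypotheses (`MastellaZerman2026.Hypotheses`: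
any odd `p`, `E[p]` irreducible, non-CM, the `p`-adic image contains `1 + pℤ_p`, …): the record gives
`char_Λ(X.X_tors) ∣ (heegnerCharIdeal D F)²`, whence the containment (`Ideal.le_of_dvd`).
[cite: MastellaZerman2026, Cor. 4.6 (arXiv:2505.08710)] -/
theorem heegnerContainment_of_cor46
    (h46 : MastellaZerman2026.cor46_howardDivisibility_of_scalarImage.{0})
    (hyp : MastellaZerman2026.Hypotheses N W K p κ γ) (jbar : AlgebraicClosure K →+* ℂ)
    (D : (W.baseChange K).LambdaAdicSelmerData κ γ) (F : HeegnerFamily N W K κ jbar)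
    (X : (W.baseChange K).SelmerDualData κ γ) :
    ∃ (jbar : AlgebraicClosure K →+* ℂ) (D : (W.baseChange K).LambdaAdicSelmerData κ γ)
      (F : HeegnerFamily N W K κ jbar) (X : (W.baseChange K).SelmerDualData κ γ),
      heegnerCharIdeal D F ^ 2 ≤
        Module.charIdeal (IwasawaAlgebra p) (Submodule.torsion (IwasawaAlgebra p) X.X) :=
  ⟨jbar, D, F, X, Ideal.le_of_dvd (MastellaZerman2026.conclusion_of_cor46 (jbar := jbar) h46 hyp D F X)⟩

/-- **Burungale–Castella–Kim 2021 Thm. 3.1 (Howard under residual irreducibility, `p ≥ 5`) discharges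
the containment hypothesis** at any data of level `N`, for its printed binders.
[cite: BurungaleCastellaKim2021, Thm. 3.1 (arXiv:1908.09512 numbering) (iv)] -/
theorem heegnerContainment_of_thm31 [W.IsElliptic]
    (h31 : BurungaleCastellaKim2021.thm31_howardThmB_of_irreducible.{0})
    (jbar : AlgebraicClosure K →+* ℂ) (hK : IsImaginaryQuadratic K)
    (hdisc : NumberField.discr K ≠ -3 ∧ NumberField.discr K ≠ -4)
    (hH : SatisfiesHeegnerHypothesis N K) (hp : 5 ≤ p) (hN : ¬ p ∣ N)
    (hdK : ¬ (p : ℤ) ∣ NumberField.discr K) (hhK : ¬ p ∣ NumberField.classNumber K)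
    (hirr : W.HasIrreducibleModPGaloisRep p) (hord : IsOrdinaryAt W p)
    (hκ : κ.IsAnticyclotomic) (hγ : κ.IsTopGenerator γ)
    (D : (W.baseChange K).LambdaAdicSelmerData κ γ) (F : HeegnerFamily N W K κ jbar)
    (X : (W.baseChange K).SelmerDualData κ γ) :
    ∃ (jbar : AlgebraicClosure K →+* ℂ) (D : (W.baseChange K).LambdaAdicSelmerData κ γ)
      (F : HeegnerFamily N W K κ jbar) (X : (W.baseChange K).SelmerDualData κ γ),
      heegnerCharIdeal D F ^ 2 ≤
        Module.charIdeal (IwasawaAlgebra p) (Submodule.torsion (IwasawaAlgebra p) X.X) :=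
  ⟨jbar, D, F, X, Ideal.le_of_dvd
    (h31 N W K p κ γ jbar hK hdisc hH hp hN hdK hhK hirr hord hκ hγ D F X).2.2.2⟩

/-- **Howard 2004 Thm. B itself (big `p`-adic image) discharges the containment hypothesis** — this
is the "(sur)" road of the printed proofs (BCS Thm. 4.2.1: "Under (sur), part (a) follows from [How04,
Thm. B], and part (b) again from [BCK21, Thm. 5.2]"), recorded to show that the fact's hypothesis is
exactly the slot where print uses the image. [cite: Howard2004HeegnerKolyvagin, §1 Thm. B]
[cite: BurungaleCastellaSkinner2025, Thm. 4.2.1, proof (p. 8)] -/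
theorem heegnerContainment_of_howard2004ThmB {jbar : AlgebraicClosure K →+* ℂ}
    (hB : Howard2004_thmB N W K p κ γ jbar) (hyp : HowardHypotheses N W K p κ γ)
    (D : (W.baseChange K).LambdaAdicSelmerData κ γ) (F : HeegnerFamily N W K κ jbar)
    (X : (W.baseChange K).SelmerDualData κ γ) :
    ∃ (jbar : AlgebraicClosure K →+* ℂ) (D : (W.baseChange K).LambdaAdicSelmerData κ γ)
      (F : HeegnerFamily N W K κ jbar) (X : (W.baseChange K).SelmerDualData κ γ),
      heegnerCharIdeal D F ^ 2 ≤
        Module.charIdeal (IwasawaAlgebra p) (Submodule.torsion (IwasawaAlgebra p) X.X) :=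
  ⟨jbar, D, F, X, Ideal.le_of_dvd (hB hyp D F X).2.2.2⟩

end Howard

/-! ### A `p`-adic valuation computation (standard API; no mathematical content of its own) -/

section Valuation

variable {p : ℕ} [hp : Fact p.Prime]

/-- `ord_p` of the right-hand side of the composite: for a unit `u ∈ ℤ_p^×`, integers `c, a`,
`L ∈ ℚ_p` and `m ∈ ℕ`, if `u · c⁻² · (1 − a p⁻¹ + p⁻¹)² · (L/m)² ≠ 0` then its valuation is
`2·(ord_p(1 − a + p) − 1 + (ord_p L − ord_p m)) − 2·ord_p c` (the siblings' computation). Private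
helper. [folklore] -/
private theorem valuation_unit_mul_bdpShape (u : ℤ_[p]ˣ) (c a : ℤ) (L : ℚ_[p]) (m : ℕ)
    (h : ((u : ℤ_[p]) : ℚ_[p]) * ((c : ℚ_[p])⁻¹) ^ 2 *
        (1 - (a : ℚ_[p]) * (p : ℚ_[p])⁻¹ + (p : ℚ_[p])⁻¹) ^ 2 * (L / (m : ℚ_[p])) ^ 2 ≠ 0) :
    (((u : ℤ_[p]) : ℚ_[p]) * ((c : ℚ_[p])⁻¹) ^ 2 *
        (1 - (a : ℚ_[p]) * (p : ℚ_[p])⁻¹ + (p : ℚ_[p])⁻¹) ^ 2 * (L / (m : ℚ_[p])) ^ 2).valuation =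
      2 * ((padicValInt p (1 - a + p) : ℤ) - 1 + (L.valuation - (padicValNat p m : ℤ))) -
        2 * (padicValInt p c : ℤ) := by
  have hp0 : (p : ℚ_[p]) ≠ 0 := by exact_mod_cast hp.out.ne_zero
  have hu0 : ((u : ℤ_[p]) : ℚ_[p]) ≠ 0 := PadicInt.coe_ne_zero.2 u.ne_zero
  have hc0 : ((c : ℚ_[p])⁻¹) ≠ 0 := by
    intro h0; apply h; rw [h0]; ring
  have hA0 : (1 - (a : ℚ_[p]) * (p : ℚ_[p])⁻¹ + (p : ℚ_[p])⁻¹) ≠ 0 := by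
    intro h0; apply h; rw [h0]; ring
  have hLm0 : L / (m : ℚ_[p]) ≠ 0 := by
    intro h0; apply h; rw [h0]; ring
  have hL0 : L ≠ 0 := by
    intro h0; apply hLm0; rw [h0, zero_div]
  have hm0 : (m : ℚ_[p]) ≠ 0 := by
    intro h0; apply hLm0; rw [h0, div_zero]
  -- `1 − a p⁻¹ + p⁻¹ = (1 − a + p)/p`
  have hAeq : (1 - (a : ℚ_[p]) * (p : ℚ_[p])⁻¹ + (p : ℚ_[p])⁻¹) =
      ((1 - a + p : ℤ) : ℚ_[p]) * (p : ℚ_[p])⁻¹ := by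
    push_cast
    field_simp
    ring
  have hA1 : ((1 - a + p : ℤ) : ℚ_[p]) ≠ 0 := by
    intro h0; apply hA0; rw [hAeq, h0, zero_mul]
  -- valuations of the four factors
  have hvu : ((u : ℤ_[p]) : ℚ_[p]).valuation = 0 := by
    simp only [PadicInt.valuation_coe, padicInt_valuation_eq_zero_of_isUnit u.isUnit, Nat.cast_zero]
  have hvc : ((c : ℚ_[p])⁻¹).valuation = -(padicValInt p c : ℤ) := by
    rw [Padic.valuation_inv, Padic.valuation_intCast]
  have hvA : (1 - (a : ℚ_[p]) * (p : ℚ_[p])⁻¹ + (p : ℚ_[p])⁻¹).valuation =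
      (padicValInt p (1 - a + p) : ℤ) - 1 := by
    rw [hAeq, Padic.valuation_mul hA1 (inv_ne_zero hp0), Padic.valuation_intCast,
      Padic.valuation_inv, Padic.valuation_p]
    ring
  have hvL : (L / (m : ℚ_[p])).valuation = L.valuation - (padicValNat p m : ℤ) := by
    rw [div_eq_mul_inv, Padic.valuation_mul hL0 (inv_ne_zero hm0), Padic.valuation_inv,
      Padic.valuation_natCast]
    ring
  rw [Padic.valuation_mul (mul_ne_zero (mul_ne_zero hu0 (pow_ne_zero 2 hc0)) (pow_ne_zero 2 hA0))
      (pow_ne_zero 2 hLm0),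
    Padic.valuation_mul (mul_ne_zero hu0 (pow_ne_zero 2 hc0)) (pow_ne_zero 2 hA0),
    Padic.valuation_mul hu0 (pow_ne_zero 2 hc0), Padic.valuation_pow, Padic.valuation_pow,
    Padic.valuation_pow, hvu, hvc, hvA, hvL]
  ring

end Valuation

/-! ### Bookkeeping consumers (at every `p ≥ 3`, no image hypothesis, modulo the Howard input) -/

section Consumers

variable {W : WeierstrassCurve ℚ} [W.IsElliptic] [W.IsGloballyMinimal] {p : ℕ} [Fact p.Prime]

/-- **Every generator satisfies the identity (with its own unit).** Granted the fact and its
hypotheses, if `Char_Λ(𝒳_{𝓕_Gr}) = (𝓖)` for ANY `𝓖 ∈ Λ`, then `𝓖(0) = u' · c_E⁻² (1 − a_p p⁻¹ + p⁻¹)²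
log_{ω_E}(P_K)²` for some `u' ∈ ℤ_p^×` (two generators of a principal ideal of the domain `Λ = ℤ_p⟦T⟧`
differ by a unit of `Λ`, whose constant term is a unit of `ℤ_p`).
[cite: YanZhu2024MainConjNonCM, Thm. 5.7 (1) and Thm. 5.9 (arXiv:2412.20078v4 l.1217–1223, l.1283–1293)]
[cite: BurungaleCastellaSkinner2025, Prop. 4.2.2 (p. 9)] [cite: CastellaGrossiLeeSkinner2022, Thm. 5.1.3] -/
theorem generator_constantCoeff_eq_of_heegnerDivisibility
    (h : thm57_thm59_bcs422_cgls513_generator_constantCoeff_of_heegnerDivisibility)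
    (hp : 3 ≤ p) (hord : GoodOrd W p)
    (K : Type) [Field K] [NumberField K] (hK : IsImaginaryQuadratic K)
    (hHN : SatisfiesHeegnerHypothesis (W.conductorNorm ℤ) K) (hHp : SatisfiesHeegnerHypothesis p K)
    (hodd : Odd (NumberField.discr K)) (h3 : NumberField.discr K ≠ -3)
    (hirrK : (W.baseChange K).HasIrreducibleModPGaloisRep p) (hhK : ¬ p ∣ NumberField.classNumber K)
    (ι : K →+* ℚ_[p]) (v vbar : HeightOneSpectrum (𝓞 K))
    (hv : ∀ x : 𝓞 K, x ∈ v.asIdeal ↔ ‖ι (x : K)‖ < 1)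
    (hvbar : ((p : ℕ) : 𝓞 K) ∈ vbar.asIdeal) (hne : vbar ≠ v)
    (κ : ZpExtension K p) (hκ : κ.IsAnticyclotomic)
    (γ : absoluteGaloisGroup K) [Fact (κ.IsTopGenerator γ)]
    {N : ℕ} [NeZero N] (Dt : ModularParametrizationData W N)
    (H : HeegnerDatum N (NumberField.discr K)) (ιC : K →+* ℂ) (P : (W.baseChange K).toAffine.Point)
    (hP : WeierstrassCurve.Affine.Point.map ιC.toRatAlgHom P = heegnerPointComplex Dt H)
    (hHow : ∃ (jbar : AlgebraicClosure K →+* ℂ) (D : (W.baseChange K).LambdaAdicSelmerData κ γ)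
      (F : HeegnerFamily N W K κ jbar) (X : (W.baseChange K).SelmerDualData κ γ),
      heegnerCharIdeal D F ^ 2 ≤
        Module.charIdeal (IwasawaAlgebra p) (Submodule.torsion (IwasawaAlgebra p) X.X))
    (G : IwasawaAlgebra p) (hG : AcSelmer.XAc.charIdeal (W.baseChange K) p κ vbar ∅ γ = Ideal.span {G}) :
    ∃ u' : ℤ_[p]ˣ,
      ((PowerSeries.constantCoeff G : ℤ_[p]) : ℚ_[p]) =
        ((u' : ℤ_[p]) : ℚ_[p]) * ((Dt.c : ℚ_[p])⁻¹) ^ 2 *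
          (1 - (W.frobeniusTrace p : ℚ_[p]) * (p : ℚ_[p])⁻¹ + (p : ℚ_[p])⁻¹) ^ 2 *
          ((W.baseChange ℚ_[p]).padicLogPoint (formalIndex W p • padicPointOf W p ι P) /
            (formalIndex W p : ℚ_[p])) ^ 2 := by
  obtain ⟨-, F, hF, u, hu⟩ := h W p hp hord K hK hHN hHp hodd h3 hirrK hhK ι v vbar hv hvbar hne
    κ hκ γ N Dt H ιC P hP hHow
  -- `G = F · w` for a unit `w` of `Λ`; `w(0)` is a unit of `ℤ_p`
  obtain ⟨w, rfl⟩ := Ideal.span_singleton_eq_span_singleton.mp (hF.symm.trans hG)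
  have hw : IsUnit (PowerSeries.constantCoeff (w : IwasawaAlgebra p)) :=
    PowerSeries.isUnit_constantCoeff _ w.isUnit
  refine ⟨u * hw.unit, ?_⟩
  rw [map_mul, PadicInt.coe_mul, hu, Units.val_mul, PadicInt.coe_mul, IsUnit.unit_spec]
  ring

/-- **The identity in valuations** — the currency of the control facts (JSW 2017 Thm. 3.3.1, printed
at `p ≥ 3` under (irr_K), no image hypothesis) and of the cells' `AcSelmer.XAc.HasCharValuationAt`:
granted the fact and its hypotheses, for EVERY generator `𝓖` of `Char_Λ(𝒳_{𝓕_Gr})` with `𝓖(0) ≠ 0`,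
`ord_p 𝓖(0) = 2·(ord_p(1 − a_p + p) − 1 + ord_p log_{ω_E} P_K) − 2·ord_p c_E`, where
`ord_p log_{ω_E} P_K = padicLogOrd W p ι P`. TWO-SIDED (the one-sided sibling
`le_valuation_generator_constantCoeff_of_thm57` has `≤` with the defect `k = μ(𝓖)`).
[cite: YanZhu2024MainConjNonCM, Thm. 5.7 (1) and Thm. 5.9 (arXiv:2412.20078v4 l.1217–1223, l.1283–1293)]
[cite: BurungaleCastellaSkinner2025, Prop. 4.2.2 (p. 9)] [cite: CastellaGrossiLeeSkinner2022, Thm. 5.1.3] -/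
theorem valuation_generator_constantCoeff_of_heegnerDivisibility
    (h : thm57_thm59_bcs422_cgls513_generator_constantCoeff_of_heegnerDivisibility)
    (hp : 3 ≤ p) (hord : GoodOrd W p)
    (K : Type) [Field K] [NumberField K] (hK : IsImaginaryQuadratic K)
    (hHN : SatisfiesHeegnerHypothesis (W.conductorNorm ℤ) K) (hHp : SatisfiesHeegnerHypothesis p K)
    (hodd : Odd (NumberField.discr K)) (h3 : NumberField.discr K ≠ -3)
    (hirrK : (W.baseChange K).HasIrreducibleModPGaloisRep p) (hhK : ¬ p ∣ NumberField.classNumber K)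
    (ι : K →+* ℚ_[p]) (v vbar : HeightOneSpectrum (𝓞 K))
    (hv : ∀ x : 𝓞 K, x ∈ v.asIdeal ↔ ‖ι (x : K)‖ < 1)
    (hvbar : ((p : ℕ) : 𝓞 K) ∈ vbar.asIdeal) (hne : vbar ≠ v)
    (κ : ZpExtension K p) (hκ : κ.IsAnticyclotomic)
    (γ : absoluteGaloisGroup K) [Fact (κ.IsTopGenerator γ)]
    {N : ℕ} [NeZero N] (Dt : ModularParametrizationData W N)
    (H : HeegnerDatum N (NumberField.discr K)) (ιC : K →+* ℂ) (P : (W.baseChange K).toAffine.Point)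
    (hP : WeierstrassCurve.Affine.Point.map ιC.toRatAlgHom P = heegnerPointComplex Dt H)
    (hHow : ∃ (jbar : AlgebraicClosure K →+* ℂ) (D : (W.baseChange K).LambdaAdicSelmerData κ γ)
      (F : HeegnerFamily N W K κ jbar) (X : (W.baseChange K).SelmerDualData κ γ),
      heegnerCharIdeal D F ^ 2 ≤
        Module.charIdeal (IwasawaAlgebra p) (Submodule.torsion (IwasawaAlgebra p) X.X))
    (G : IwasawaAlgebra p) (hG : AcSelmer.XAc.charIdeal (W.baseChange K) p κ vbar ∅ γ = Ideal.span {G})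
    (hG0 : PowerSeries.constantCoeff G ≠ 0) :
    ((PowerSeries.constantCoeff G).valuation : ℤ) =
      2 * ((padicValInt p (1 - W.frobeniusTrace p + p) : ℤ) - 1 + padicLogOrd W p ι P) -
        2 * (padicValInt p Dt.c : ℤ) := by
  obtain ⟨u', hu'⟩ := generator_constantCoeff_eq_of_heegnerDivisibility h hp hord K hK hHN hHp hodd
    h3 hirrK hhK ι v vbar hv hvbar hne κ hκ γ Dt H ιC P hP hHow G hG
  -- the left-hand side is non-zero, hence so is the right-hand side
  have hrhs : ((u' : ℤ_[p]) : ℚ_[p]) * ((Dt.c : ℚ_[p])⁻¹) ^ 2 *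
      (1 - (W.frobeniusTrace p : ℚ_[p]) * (p : ℚ_[p])⁻¹ + (p : ℚ_[p])⁻¹) ^ 2 *
      ((W.baseChange ℚ_[p]).padicLogPoint (formalIndex W p • padicPointOf W p ι P) /
        (formalIndex W p : ℚ_[p])) ^ 2 ≠ 0 := by
    rw [← hu']
    exact PadicInt.coe_ne_zero.2 hG0
  have hval := congrArg Padic.valuation hu'
  rw [PadicInt.valuation_coe, valuation_unit_mul_bdpShape u' Dt.c (W.frobeniusTrace p) _ _ hrhs]
    at hval
  rw [hval, padicLogOrd]

/-- **The composite in the packaged currency** `AcSelmer.XAc.HasCharValuationAt … n` ("`𝒳_{𝓕_Gr}` is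
`Λ`-torsion with a generator `𝓕`, `𝓕(0) ≠ 0`, `ord_p 𝓕(0) = n`") `∧ n = 2·(ord_p(1 − a_p + p) − 1 +
ord_p log_{ω_E} P_K) − 2·ord_p c_E` — granted the fact, its hypotheses, and ONE generator with non-zero
constant term (at the cells' data: a control theorem, JSW Thm. 3.3.1, `p ≥ 3`, (irr_K)). Up to the Manin
term `2·ord_p c_E` and the log-prime convention this is LITERALLY the body of the cells' Summits
predicate `X11b.IMCWaldspurgerOnTreeGoodAt p κ vbar γ ι P` ((IMC∘BDP)ᵍ at `𝟙`, TWO-SIDED) — fed here, at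
EVERY good ordinary `p ≥ 3` with (irr_K), WITHOUT any image hypothesis, by published facts PLUS the
Howard-side containment (the (sur)-sibling `hasCharValuationAt_of_thm124b` needs `3 < p` and `Surj W p`).
[cite: YanZhu2024MainConjNonCM, Thm. 5.7 (1) and Thm. 5.9 (arXiv:2412.20078v4 l.1217–1223, l.1283–1293)]
[cite: BurungaleCastellaSkinner2025, Prop. 4.2.2 (p. 9)] [cite: CastellaGrossiLeeSkinner2022, Thm. 5.1.3]
[cite: Castella2018, §5 (eq:IMC+BDP) (arXiv:1704.06608 p. 12) (the same shape at `p ∣ N`)] -/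
theorem hasCharValuationAt_of_heegnerDivisibility
    (h : thm57_thm59_bcs422_cgls513_generator_constantCoeff_of_heegnerDivisibility)
    (hp : 3 ≤ p) (hord : GoodOrd W p)
    (K : Type) [Field K] [NumberField K] (hK : IsImaginaryQuadratic K)
    (hHN : SatisfiesHeegnerHypothesis (W.conductorNorm ℤ) K) (hHp : SatisfiesHeegnerHypothesis p K)
    (hodd : Odd (NumberField.discr K)) (h3 : NumberField.discr K ≠ -3)
    (hirrK : (W.baseChange K).HasIrreducibleModPGaloisRep p) (hhK : ¬ p ∣ NumberField.classNumber K)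
    (ι : K →+* ℚ_[p]) (v vbar : HeightOneSpectrum (𝓞 K))
    (hv : ∀ x : 𝓞 K, x ∈ v.asIdeal ↔ ‖ι (x : K)‖ < 1)
    (hvbar : ((p : ℕ) : 𝓞 K) ∈ vbar.asIdeal) (hne : vbar ≠ v)
    (κ : ZpExtension K p) (hκ : κ.IsAnticyclotomic)
    (γ : absoluteGaloisGroup K) [Fact (κ.IsTopGenerator γ)]
    {N : ℕ} [NeZero N] (Dt : ModularParametrizationData W N)
    (H : HeegnerDatum N (NumberField.discr K)) (ιC : K →+* ℂ) (P : (W.baseChange K).toAffine.Point)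
    (hP : WeierstrassCurve.Affine.Point.map ιC.toRatAlgHom P = heegnerPointComplex Dt H)
    (hHow : ∃ (jbar : AlgebraicClosure K →+* ℂ) (D : (W.baseChange K).LambdaAdicSelmerData κ γ)
      (F : HeegnerFamily N W K κ jbar) (X : (W.baseChange K).SelmerDualData κ γ),
      heegnerCharIdeal D F ^ 2 ≤
        Module.charIdeal (IwasawaAlgebra p) (Submodule.torsion (IwasawaAlgebra p) X.X))
    (G : IwasawaAlgebra p) (hG : AcSelmer.XAc.charIdeal (W.baseChange K) p κ vbar ∅ γ = Ideal.span {G})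
    (hG0 : PowerSeries.constantCoeff G ≠ 0) :
    ∃ n : ℕ, AcSelmer.XAc.HasCharValuationAt (W.baseChange K) p κ vbar ∅ γ n ∧
      (n : ℤ) = 2 * ((padicValInt p (1 - W.frobeniusTrace p + p) : ℤ) - 1 + padicLogOrd W p ι P) -
        2 * (padicValInt p Dt.c : ℤ) := by
  obtain ⟨htors, -⟩ := h W p hp hord K hK hHN hHp hodd h3 hirrK hhK ι v vbar hv hvbar hne κ hκ γ N
    Dt H ιC P hP hHow
  exact ⟨(PowerSeries.constantCoeff G).valuation,
    AcSelmer.XAc.hasCharValuationAt_of_eq htors hG hG0 rfl,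
    valuation_generator_constantCoeff_of_heegnerDivisibility h hp hord K hK hHN hHp hodd h3 hirrK hhK
      ι v vbar hv hvbar hne κ hκ γ Dt H ιC P hP hHow G hG hG0⟩

/-- **The X9/X10b consumer edge: the composite fed by Mastella–Zerman's record.** Granted the fact AND
the named fact `MastellaZerman2026.cor46_howardDivisibility_of_scalarImage` (Howard's Theorem B at ANY
odd `p` under (irr) + "the `p`-adic image contains `1 + pℤ_p`" + non-CM), for `(E, K, p)` meeting both
binder lists and ANY data `(jbar, D, F, X)` at the parametrisation level `N` (the data exist by
`exists_isHeegnerNormPoint` / `lambdaAdicSelmerData_exists_unique`; here they are arguments), the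
INTEGRAL identity at `𝟙` holds: `𝒳_{𝓕_Gr}` torsion, `Char = (F)`, `F(0) = u · c_E⁻² (1 − a_p p⁻¹ +
p⁻¹)² log_{ω_E}(P_K)²`, `u ∈ ℤ_p^×` — at `p = 3, 5, 7` alike, with NO surjectivity anywhere; the
image input is the scalar certificate `MastellaZerman2026.HasPadicScalarImage W p` inside `hypMZ`.
Bookkeeping only (one application of each fact).
[cite: MastellaZerman2026, Cor. 4.6 (arXiv:2505.08710)]
[cite: YanZhu2024MainConjNonCM, Thm. 5.7 (1) and Thm. 5.9] [cite: BurungaleCastellaSkinner2025, Prop. 4.2.2]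
[cite: CastellaGrossiLeeSkinner2022, Thm. 5.1.3] -/
theorem generator_constantCoeff_of_cor46
    (h : thm57_thm59_bcs422_cgls513_generator_constantCoeff_of_heegnerDivisibility)
    (h46 : MastellaZerman2026.cor46_howardDivisibility_of_scalarImage.{0})
    (hp : 3 ≤ p) (hord : GoodOrd W p)
    (K : Type) [Field K] [NumberField K] (hK : IsImaginaryQuadratic K)
    (hHN : SatisfiesHeegnerHypothesis (W.conductorNorm ℤ) K) (hHp : SatisfiesHeegnerHypothesis p K)
    (hodd : Odd (NumberField.discr K)) (h3 : NumberField.discr K ≠ -3)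
    (hirrK : (W.baseChange K).HasIrreducibleModPGaloisRep p)
    (ι : K →+* ℚ_[p]) (v vbar : HeightOneSpectrum (𝓞 K))
    (hv : ∀ x : 𝓞 K, x ∈ v.asIdeal ↔ ‖ι (x : K)‖ < 1)
    (hvbar : ((p : ℕ) : 𝓞 K) ∈ vbar.asIdeal) (hne : vbar ≠ v)
    (κ : ZpExtension K p) (γ : absoluteGaloisGroup K) [Fact (κ.IsTopGenerator γ)]
    {N : ℕ} [NeZero N] (hypMZ : MastellaZerman2026.Hypotheses N W K p κ γ)
    (Dt : ModularParametrizationData W N)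
    (H : HeegnerDatum N (NumberField.discr K)) (ιC : K →+* ℂ) (P : (W.baseChange K).toAffine.Point)
    (hP : WeierstrassCurve.Affine.Point.map ιC.toRatAlgHom P = heegnerPointComplex Dt H)
    (jbar : AlgebraicClosure K →+* ℂ) (D : (W.baseChange K).LambdaAdicSelmerData κ γ)
    (F : HeegnerFamily N W K κ jbar) (X : (W.baseChange K).SelmerDualData κ γ) :
    Module.IsTorsion (IwasawaAlgebra p) (AcSelmer.XAc (W.baseChange K) p κ vbar ∅ γ) ∧
      ∃ F : IwasawaAlgebra p,
        AcSelmer.XAc.charIdeal (W.baseChange K) p κ vbar ∅ γ = Ideal.span {F} ∧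
        ∃ u : ℤ_[p]ˣ,
          ((PowerSeries.constantCoeff F : ℤ_[p]) : ℚ_[p]) =
            ((u : ℤ_[p]) : ℚ_[p]) * ((Dt.c : ℚ_[p])⁻¹) ^ 2 *
              (1 - (W.frobeniusTrace p : ℚ_[p]) * (p : ℚ_[p])⁻¹ + (p : ℚ_[p])⁻¹) ^ 2 *
              ((W.baseChange ℚ_[p]).padicLogPoint (formalIndex W p • padicPointOf W p ι P) /
                (formalIndex W p : ℚ_[p])) ^ 2 :=
  h W p hp hord K hK hHN hHp hodd h3 hirrK hypMZ.not_dvd_classNumber ι v vbar hv hvbar hne κ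
    hypMZ.anticyclotomic γ N Dt H ιC P hP (heegnerContainment_of_cor46 h46 hypMZ jbar D F X)

end Consumers

/-! ## The PINNED twin (print's normalisation of the Heegner class: `p ∤ c_π`) and its bookkeeping -/

/-- **Yan–Zhu 2026 Thm. 5.7 (1) (rational sentence) and Thm. 5.9, Burungale–Castella–Skinner 2025
Prop. 4.2.2 and Castella–Grossi–Lee–Skinner 2022 Thm. 5.1.3, composed on the one object `𝓛_p^BDP(E/K)`
AT THE TRIVIAL CHARACTER, GRANTED Howard's Heegner-point containment FOR A FAMILY OF `p`-ADIC-UNIT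
MANIN CONSTANT** — the PINNED twin of
`thm57_thm59_bcs422_cgls513_generator_constantCoeff_of_heegnerDivisibility`: the same binders, the same
four printed statements (quoted in that docstring and the module docstring: Thm. 5.7 (1) first
sentence; Thm. 5.9 "for every nontrivial multiplicative set `S ⊂ Λ_K⁻` … equivalent … The same result
holds for the opposite divisibilities"; Prop. 4.2.2 "`μ(L_p^Gr(g/K)) = μ(L_p^BDP(g/K)) = 0`"; Thm.
5.1.3 "`𝓛_E(0) = c_E⁻² · (1 − a_p p⁻¹ + p⁻¹)² · log_{ω_E}(P_K)²`"), the same conclusion letter for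
letter (`𝒳_{𝓕_Gr}` is `Λ`-torsion and a generator `𝓕` of `Char_Λ(𝒳_{𝓕_Gr})` has `𝓕(0) = u · c_E⁻²
(1 − a_p p⁻¹ + p⁻¹)² log_{ω_E}(P_K)²`, `u ∈ ℤ_p^×`), with the containment HYPOTHESIS now carrying
print's normalisation of the Heegner class VERBATIM: "for some `jbar`, `Λ`-adic Selmer datum `D`,
Heegner family `F` at level `N` WITH `¬ (p : ℤ) ∣ F.Dt.c`, and dual datum `X`,
`(heegnerCharIdeal D F)² ≤ char_Λ(X.X_tors)`". THE PIN is the printed hypothesis under which step (iii)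
(Thm. 5.9 = "Similarly to [BCK]", BCK21 Thm. 5.2) is EXACT — Burungale–Castella–Kim, ANT 15 (2021),
Remark 1.2: "As formulated in [PR87, Conj. B], the second equality of characteristic ideals in (ii)
includes the factor `c_π · (#𝒪_K^×)/2`, where `c_π ∈ ℤ_{>0}` is the Manin constant associated to `π`.
However, `𝒪_K^× = {±1}` by our hypothesis (disc), and `c_π` is a `p`-adic unit by [Mazur] and our
hypothesis that `p ∤ N`"; App. A: "`E` … `(ℤ, pℤ_p)`-optimal … `π : J(X_{N⁺,N⁻}) → E` the quotient
map"; proof of Thm. 5.2, eq. (A4): `ord_{𝔓'}(𝓛_𝔭^BDP) = length(coker(loc_𝔭)Λ^ur) + length(𝒮^ur/Λ^ur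
κ_∞)` (exact, via the explicit reciprocity law Thm. 4.4 `Log_𝔭(loc_𝔭 κ_∞) = −𝓛_𝔭^BDP σ_{−1,𝔭}`);
Castella–Grossi–Lee–Skinner 2022 §1 Conj. 1: `char_Λ(X_tors) = (c_E² u_K²)⁻¹ · char_Λ(𝒮/Λκ₁^Hg)²`,
`π^*(ω_E) = c_E · 2πi f dτ`. In the tree `F.Dt.c` IS that constant (`φ = uniformize (c · 2πi ∫ f)`)
and `u_K = 1` under the binders (`D_K` odd, `≠ −3`). The algebra (i)–(iv) of the module docstring then
runs as printed: `p^a 𝓕 = w p^b L`, `p ∤ L`, `L ∈ (𝓕)R` (from the pinned Thm. 5.9 at the pinned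
family) ⟹ `(𝓕)R = (L)`, `𝓕(0) = w(0) L(𝟙)`. WEAKER than the unpinned fact
(`thm57_thm59_bcs422_cgls513_pinned_of_unpinned`); COMPOSITE OF FOUR PRINTED, PUBLISHED THEOREMS (flag
`YZ26-57i+59+BCS422+CGLS513-composite`; at `p = 3` the cell flag `YZ26@3-BF-ERL-Ohta`); NO image
hypothesis; nothing asserted.
[cite: YanZhu2024MainConjNonCM, Thm. 5.7 (1), first sentence, and Thm. 5.9 (§5.2; arXiv:2412.20078v4 TeX l.1217–1223, l.1283–1293; = arXiv v2 Thm. 4.12 (1), Thm. 4.14, p0011 L66–L72, L96–L105) with setting l.1189–1190 (v2 p0011 L49–L52, "Fix a modular parametrization" L59), §3.5 and Thm. 3.13; proof of Thm. 5.7 (v2 p0011 L107–L115)]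
[cite: BurungaleCastellaKim2021, Remark 1.2 (arXiv:1908.09512v2 TeX l.192–195); Thm. 5.2 (journal) = TeX l.1044–1097 with eq. (A4) l.1079–1081; Thm. 4.4 eq. (ERL) l.929–941; App. A l.1116–1120]
[cite: CastellaGrossiLeeSkinner2022, §1 Conj. 1 (arXiv:2008.02571 p0003 L39–L47) and Thm. 5.1.3 (p0024 L78–L82) with §5.1.2 (p0024 L60–L66)]
[cite: BurungaleCastellaSkinner2025, Prop. 4.2.2 (p. 9; arXiv:2405.00270v2 p0009 L2–L7) with (disc)/(Heeg)/(spl) (§1.2) and (irr_K) (p. 7); Thm. 4.2.1 and its proof (p. 8)]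
[cite: Hsieh2014, Thm. B (the source of Prop. 4.2.2, as cited by BCS)]
[cite: BertoliniDarmonPrasanna2013, Thm. 5.13 (the source of Thm. 5.1.3)]
[cite: Howard2004HeegnerKolyvagin, §1 Thm. B and Thm. 3.3.7 (the currency `heegnerCharIdeal`, `𝐇 = Λκ`)] -/
def thm57_thm59_bcs422_cgls513_generator_constantCoeff_of_pinnedHeegnerDivisibility : Prop :=
  ∀ (W : WeierstrassCurve ℚ) [W.IsElliptic] [W.IsGloballyMinimal] (p : ℕ) [Fact p.Prime],
    3 ≤ p → GoodOrd W p →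
    ∀ (K : Type) [Field K] [NumberField K], IsImaginaryQuadratic K →
      SatisfiesHeegnerHypothesis (W.conductorNorm ℤ) K → SatisfiesHeegnerHypothesis p K →
      Odd (NumberField.discr K) → NumberField.discr K ≠ -3 →
      (W.baseChange K).HasIrreducibleModPGaloisRep p →
      ¬ p ∣ NumberField.classNumber K →
    ∀ (ι : K →+* ℚ_[p]) (v vbar : HeightOneSpectrum (𝓞 K)),
      (∀ x : 𝓞 K, x ∈ v.asIdeal ↔ ‖ι (x : K)‖ < 1) →
      ((p : ℕ) : 𝓞 K) ∈ vbar.asIdeal → vbar ≠ v →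
    ∀ (κ : ZpExtension K p), κ.IsAnticyclotomic →
    ∀ (γ : absoluteGaloisGroup K) [Fact (κ.IsTopGenerator γ)],
    ∀ (N : ℕ) [NeZero N] (Dt : ModularParametrizationData W N)
      (H : HeegnerDatum N (NumberField.discr K)) (ιC : K →+* ℂ) (P : (W.baseChange K).toAffine.Point),
      WeierstrassCurve.Affine.Point.map ιC.toRatAlgHom P = heegnerPointComplex Dt H →
      (∃ (jbar : AlgebraicClosure K →+* ℂ) (D : (W.baseChange K).LambdaAdicSelmerData κ γ)
          (F : HeegnerFamily N W K κ jbar) (X : (W.baseChange K).SelmerDualData κ γ),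
          ¬ (p : ℤ) ∣ F.Dt.c ∧
          heegnerCharIdeal D F ^ 2 ≤
            Module.charIdeal (IwasawaAlgebra p) (Submodule.torsion (IwasawaAlgebra p) X.X)) →
      Module.IsTorsion (IwasawaAlgebra p) (AcSelmer.XAc (W.baseChange K) p κ vbar ∅ γ) ∧
      ∃ F : IwasawaAlgebra p,
        AcSelmer.XAc.charIdeal (W.baseChange K) p κ vbar ∅ γ = Ideal.span {F} ∧
        ∃ u : ℤ_[p]ˣ,
          ((PowerSeries.constantCoeff F : ℤ_[p]) : ℚ_[p]) =
            ((u : ℤ_[p]) : ℚ_[p]) * ((Dt.c : ℚ_[p])⁻¹) ^ 2 *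
              (1 - (W.frobeniusTrace p : ℚ_[p]) * (p : ℚ_[p])⁻¹ + (p : ℚ_[p])⁻¹) ^ 2 *
              ((W.baseChange ℚ_[p]).padicLogPoint (formalIndex W p • padicPointOf W p ι P) /
                (formalIndex W p : ℚ_[p])) ^ 2

/-- **The pinned composite is implied by the unpinned one** (its hypothesis asks MORE of the family,
so the fact asserts LESS): bookkeeping, recorded so that the pinned fact is visibly WEAKER than the
accepted typing — never stronger than the sources. [cite: YanZhu2024MainConjNonCM, Thm. 5.7 (1) and Thm. 5.9]
[cite: BurungaleCastellaKim2021, Remark 1.2 (arXiv:1908.09512v2 TeX l.192–195)] -/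
theorem thm57_thm59_bcs422_cgls513_pinned_of_unpinned
    (h : thm57_thm59_bcs422_cgls513_generator_constantCoeff_of_heegnerDivisibility) :
    thm57_thm59_bcs422_cgls513_generator_constantCoeff_of_pinnedHeegnerDivisibility := by
  intro W _ _ p _ hp hord K _ _ hK hHN hHp hodd h3 hirrK hhK ι v vbar hv hvbar hne κ hκ γ _ N _ Dt H
    ιC P hP hHow
  obtain ⟨jbar, D, F, X, -, hle⟩ := hHow
  exact h W p hp hord K hK hHN hHp hodd h3 hirrK hhK ι v vbar hv hvbar hne κ hκ γ N Dt H ιC P hP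
    ⟨jbar, D, F, X, hle⟩

/-! ### Discharging the PINNED Howard-side hypothesis from the tree's records (bookkeeping): the three
records conclude the containment for ALL data, hence for pinned families; the pin `hc` is an argument
(at a leaf: the frame's `¬ (p : ℤ) ∣ Dt.c` transported along the tie `F.Dt = Dt` of
`exists_heegnerFamily_Dt_eq`). -/

section HowardPinned

variable {p : ℕ} [Fact p.Prime] {N : ℕ} [NeZero N] {W : WeierstrassCurve ℚ} [W.IsGloballyMinimal]
  {K : Type} [Field K] [NumberField K] {κ : ZpExtension K p} {γ : absoluteGaloisGroup K}

/-- **Mastella–Zerman 2026 Cor. 4.6 discharges the PINNED containment hypothesis** at any data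
`(jbar, D, F, X)` of level `N` whose family has `p`-adic-unit Manin constant (`hc`), for `(E, K, p)`
satisfying its printed hypotheses (`MastellaZerman2026.Hypotheses`).
[cite: MastellaZerman2026, Cor. 4.6 (arXiv:2505.08710)]
[cite: BurungaleCastellaKim2021, Remark 1.2 (arXiv:1908.09512v2 TeX l.192–195) (the pin)] -/
theorem pinnedHeegnerContainment_of_cor46
    (h46 : MastellaZerman2026.cor46_howardDivisibility_of_scalarImage.{0})
    (hyp : MastellaZerman2026.Hypotheses N W K p κ γ) (jbar : AlgebraicClosure K →+* ℂ)
    (D : (W.baseChange K).LambdaAdicSelmerData κ γ) (F : HeegnerFamily N W K κ jbar)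
    (X : (W.baseChange K).SelmerDualData κ γ) (hc : ¬ (p : ℤ) ∣ F.Dt.c) :
    ∃ (jbar : AlgebraicClosure K →+* ℂ) (D : (W.baseChange K).LambdaAdicSelmerData κ γ)
      (F : HeegnerFamily N W K κ jbar) (X : (W.baseChange K).SelmerDualData κ γ),
      ¬ (p : ℤ) ∣ F.Dt.c ∧
      heegnerCharIdeal D F ^ 2 ≤
        Module.charIdeal (IwasawaAlgebra p) (Submodule.torsion (IwasawaAlgebra p) X.X) :=
  ⟨jbar, D, F, X, hc,
    Ideal.le_of_dvd (MastellaZerman2026.conclusion_of_cor46 (jbar := jbar) h46 hyp D F X)⟩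

/-- **Burungale–Castella–Kim 2021 Thm. 3.1 (arXiv-v1 numbering; Howard under residual irreducibility,
`p ≥ 5`) discharges the PINNED containment hypothesis** at any data of level `N` whose family has
`p`-adic-unit Manin constant (`hc`), for its printed binders.
[cite: BurungaleCastellaKim2021, Thm. 3.1 (arXiv:1908.09512v1 numbering) (iv); Remark 1.2 (v2 TeX l.192–195) (the pin)] -/
theorem pinnedHeegnerContainment_of_thm31 [W.IsElliptic]
    (h31 : BurungaleCastellaKim2021.thm31_howardThmB_of_irreducible.{0})
    (jbar : AlgebraicClosure K →+* ℂ) (hK : IsImaginaryQuadratic K)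
    (hdisc : NumberField.discr K ≠ -3 ∧ NumberField.discr K ≠ -4)
    (hH : SatisfiesHeegnerHypothesis N K) (hp : 5 ≤ p) (hN : ¬ p ∣ N)
    (hdK : ¬ (p : ℤ) ∣ NumberField.discr K) (hhK : ¬ p ∣ NumberField.classNumber K)
    (hirr : W.HasIrreducibleModPGaloisRep p) (hord : IsOrdinaryAt W p)
    (hκ : κ.IsAnticyclotomic) (hγ : κ.IsTopGenerator γ)
    (D : (W.baseChange K).LambdaAdicSelmerData κ γ) (F : HeegnerFamily N W K κ jbar)
    (X : (W.baseChange K).SelmerDualData κ γ) (hc : ¬ (p : ℤ) ∣ F.Dt.c) :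
    ∃ (jbar : AlgebraicClosure K →+* ℂ) (D : (W.baseChange K).LambdaAdicSelmerData κ γ)
      (F : HeegnerFamily N W K κ jbar) (X : (W.baseChange K).SelmerDualData κ γ),
      ¬ (p : ℤ) ∣ F.Dt.c ∧
      heegnerCharIdeal D F ^ 2 ≤
        Module.charIdeal (IwasawaAlgebra p) (Submodule.torsion (IwasawaAlgebra p) X.X) :=
  ⟨jbar, D, F, X, hc, Ideal.le_of_dvd
    (h31 N W K p κ γ jbar hK hdisc hH hp hN hdK hhK hirr hord hκ hγ D F X).2.2.2⟩

/-- **Howard 2004 Thm. B itself (big `p`-adic image) discharges the PINNED containment hypothesis**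
at any data whose family has `p`-adic-unit Manin constant (`hc`) — the "(sur)" road of the printed
proofs (BCS Thm. 4.2.1: "(a) follows from [How04, Thm. B], and part (b) again from [BCK21, Thm. 5.2]").
[cite: Howard2004HeegnerKolyvagin, §1 Thm. B] [cite: BurungaleCastellaSkinner2025, Thm. 4.2.1, proof (p. 8)]
[cite: BurungaleCastellaKim2021, Remark 1.2 (arXiv:1908.09512v2 TeX l.192–195) (the pin)] -/
theorem pinnedHeegnerContainment_of_howard2004ThmB {jbar : AlgebraicClosure K →+* ℂ}
    (hB : Howard2004_thmB N W K p κ γ jbar) (hyp : HowardHypotheses N W K p κ γ)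
    (D : (W.baseChange K).LambdaAdicSelmerData κ γ) (F : HeegnerFamily N W K κ jbar)
    (X : (W.baseChange K).SelmerDualData κ γ) (hc : ¬ (p : ℤ) ∣ F.Dt.c) :
    ∃ (jbar : AlgebraicClosure K →+* ℂ) (D : (W.baseChange K).LambdaAdicSelmerData κ γ)
      (F : HeegnerFamily N W K κ jbar) (X : (W.baseChange K).SelmerDualData κ γ),
      ¬ (p : ℤ) ∣ F.Dt.c ∧
      heegnerCharIdeal D F ^ 2 ≤
        Module.charIdeal (IwasawaAlgebra p) (Submodule.torsion (IwasawaAlgebra p) X.X) :=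
  ⟨jbar, D, F, X, hc, Ideal.le_of_dvd (hB hyp D F X).2.2.2⟩

end HowardPinned

/-! ### Bookkeeping consumers of the PINNED fact (at every `p ≥ 3`, no image hypothesis, modulo the
pinned Howard input) — word for word the unpinned consumers, with the pinned hypothesis -/

section ConsumersPinned

variable {W : WeierstrassCurve ℚ} [W.IsElliptic] [W.IsGloballyMinimal] {p : ℕ} [Fact p.Prime]

/-- **Every generator satisfies the identity (with its own unit)** — pinned twin of
`generator_constantCoeff_eq_of_heegnerDivisibility`.
[cite: YanZhu2024MainConjNonCM, Thm. 5.7 (1) and Thm. 5.9 (arXiv:2412.20078v4 l.1217–1223, l.1283–1293)]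
[cite: BurungaleCastellaSkinner2025, Prop. 4.2.2 (p. 9)] [cite: CastellaGrossiLeeSkinner2022, Thm. 5.1.3]
[cite: BurungaleCastellaKim2021, Remark 1.2 (arXiv:1908.09512v2 TeX l.192–195) (the pin)] -/
theorem generator_constantCoeff_eq_of_pinnedHeegnerDivisibility
    (h : thm57_thm59_bcs422_cgls513_generator_constantCoeff_of_pinnedHeegnerDivisibility)
    (hp : 3 ≤ p) (hord : GoodOrd W p)
    (K : Type) [Field K] [NumberField K] (hK : IsImaginaryQuadratic K)
    (hHN : SatisfiesHeegnerHypothesis (W.conductorNorm ℤ) K) (hHp : SatisfiesHeegnerHypothesis p K)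
    (hodd : Odd (NumberField.discr K)) (h3 : NumberField.discr K ≠ -3)
    (hirrK : (W.baseChange K).HasIrreducibleModPGaloisRep p) (hhK : ¬ p ∣ NumberField.classNumber K)
    (ι : K →+* ℚ_[p]) (v vbar : HeightOneSpectrum (𝓞 K))
    (hv : ∀ x : 𝓞 K, x ∈ v.asIdeal ↔ ‖ι (x : K)‖ < 1)
    (hvbar : ((p : ℕ) : 𝓞 K) ∈ vbar.asIdeal) (hne : vbar ≠ v)
    (κ : ZpExtension K p) (hκ : κ.IsAnticyclotomic)
    (γ : absoluteGaloisGroup K) [Fact (κ.IsTopGenerator γ)]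
    {N : ℕ} [NeZero N] (Dt : ModularParametrizationData W N)
    (H : HeegnerDatum N (NumberField.discr K)) (ιC : K →+* ℂ) (P : (W.baseChange K).toAffine.Point)
    (hP : WeierstrassCurve.Affine.Point.map ιC.toRatAlgHom P = heegnerPointComplex Dt H)
    (hHow : ∃ (jbar : AlgebraicClosure K →+* ℂ) (D : (W.baseChange K).LambdaAdicSelmerData κ γ)
      (F : HeegnerFamily N W K κ jbar) (X : (W.baseChange K).SelmerDualData κ γ),
      ¬ (p : ℤ) ∣ F.Dt.c ∧
      heegnerCharIdeal D F ^ 2 ≤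
        Module.charIdeal (IwasawaAlgebra p) (Submodule.torsion (IwasawaAlgebra p) X.X))
    (G : IwasawaAlgebra p) (hG : AcSelmer.XAc.charIdeal (W.baseChange K) p κ vbar ∅ γ = Ideal.span {G}) :
    ∃ u' : ℤ_[p]ˣ,
      ((PowerSeries.constantCoeff G : ℤ_[p]) : ℚ_[p]) =
        ((u' : ℤ_[p]) : ℚ_[p]) * ((Dt.c : ℚ_[p])⁻¹) ^ 2 *
          (1 - (W.frobeniusTrace p : ℚ_[p]) * (p : ℚ_[p])⁻¹ + (p : ℚ_[p])⁻¹) ^ 2 *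
          ((W.baseChange ℚ_[p]).padicLogPoint (formalIndex W p • padicPointOf W p ι P) /
            (formalIndex W p : ℚ_[p])) ^ 2 := by
  obtain ⟨-, F, hF, u, hu⟩ := h W p hp hord K hK hHN hHp hodd h3 hirrK hhK ι v vbar hv hvbar hne
    κ hκ γ N Dt H ιC P hP hHow
  -- `G = F · w` for a unit `w` of `Λ`; `w(0)` is a unit of `ℤ_p`
  obtain ⟨w, rfl⟩ := Ideal.span_singleton_eq_span_singleton.mp (hF.symm.trans hG)
  have hw : IsUnit (PowerSeries.constantCoeff (w : IwasawaAlgebra p)) :=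
    PowerSeries.isUnit_constantCoeff _ w.isUnit
  refine ⟨u * hw.unit, ?_⟩
  rw [map_mul, PadicInt.coe_mul, hu, Units.val_mul, PadicInt.coe_mul, IsUnit.unit_spec]
  ring

/-- **The identity in valuations** — pinned twin of
`valuation_generator_constantCoeff_of_heegnerDivisibility`: granted the pinned fact and its hypotheses,
for EVERY generator `𝓖` of `Char_Λ(𝒳_{𝓕_Gr})` with `𝓖(0) ≠ 0`,
`ord_p 𝓖(0) = 2·(ord_p(1 − a_p + p) − 1 + ord_p log_{ω_E} P_K) − 2·ord_p c_E`.
[cite: YanZhu2024MainConjNonCM, Thm. 5.7 (1) and Thm. 5.9 (arXiv:2412.20078v4 l.1217–1223, l.1283–1293)]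
[cite: BurungaleCastellaSkinner2025, Prop. 4.2.2 (p. 9)] [cite: CastellaGrossiLeeSkinner2022, Thm. 5.1.3]
[cite: BurungaleCastellaKim2021, Remark 1.2 (arXiv:1908.09512v2 TeX l.192–195) (the pin)] -/
theorem valuation_generator_constantCoeff_of_pinnedHeegnerDivisibility
    (h : thm57_thm59_bcs422_cgls513_generator_constantCoeff_of_pinnedHeegnerDivisibility)
    (hp : 3 ≤ p) (hord : GoodOrd W p)
    (K : Type) [Field K] [NumberField K] (hK : IsImaginaryQuadratic K)
    (hHN : SatisfiesHeegnerHypothesis (W.conductorNorm ℤ) K) (hHp : SatisfiesHeegnerHypothesis p K)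
    (hodd : Odd (NumberField.discr K)) (h3 : NumberField.discr K ≠ -3)
    (hirrK : (W.baseChange K).HasIrreducibleModPGaloisRep p) (hhK : ¬ p ∣ NumberField.classNumber K)
    (ι : K →+* ℚ_[p]) (v vbar : HeightOneSpectrum (𝓞 K))
    (hv : ∀ x : 𝓞 K, x ∈ v.asIdeal ↔ ‖ι (x : K)‖ < 1)
    (hvbar : ((p : ℕ) : 𝓞 K) ∈ vbar.asIdeal) (hne : vbar ≠ v)
    (κ : ZpExtension K p) (hκ : κ.IsAnticyclotomic)
    (γ : absoluteGaloisGroup K) [Fact (κ.IsTopGenerator γ)]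
    {N : ℕ} [NeZero N] (Dt : ModularParametrizationData W N)
    (H : HeegnerDatum N (NumberField.discr K)) (ιC : K →+* ℂ) (P : (W.baseChange K).toAffine.Point)
    (hP : WeierstrassCurve.Affine.Point.map ιC.toRatAlgHom P = heegnerPointComplex Dt H)
    (hHow : ∃ (jbar : AlgebraicClosure K →+* ℂ) (D : (W.baseChange K).LambdaAdicSelmerData κ γ)
      (F : HeegnerFamily N W K κ jbar) (X : (W.baseChange K).SelmerDualData κ γ),
      ¬ (p : ℤ) ∣ F.Dt.c ∧
      heegnerCharIdeal D F ^ 2 ≤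
        Module.charIdeal (IwasawaAlgebra p) (Submodule.torsion (IwasawaAlgebra p) X.X))
    (G : IwasawaAlgebra p) (hG : AcSelmer.XAc.charIdeal (W.baseChange K) p κ vbar ∅ γ = Ideal.span {G})
    (hG0 : PowerSeries.constantCoeff G ≠ 0) :
    ((PowerSeries.constantCoeff G).valuation : ℤ) =
      2 * ((padicValInt p (1 - W.frobeniusTrace p + p) : ℤ) - 1 + padicLogOrd W p ι P) -
        2 * (padicValInt p Dt.c : ℤ) := by
  obtain ⟨u', hu'⟩ := generator_constantCoeff_eq_of_pinnedHeegnerDivisibility h hp hord K hK hHN hHp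
    hodd h3 hirrK hhK ι v vbar hv hvbar hne κ hκ γ Dt H ιC P hP hHow G hG
  -- the left-hand side is non-zero, hence so is the right-hand side
  have hrhs : ((u' : ℤ_[p]) : ℚ_[p]) * ((Dt.c : ℚ_[p])⁻¹) ^ 2 *
      (1 - (W.frobeniusTrace p : ℚ_[p]) * (p : ℚ_[p])⁻¹ + (p : ℚ_[p])⁻¹) ^ 2 *
      ((W.baseChange ℚ_[p]).padicLogPoint (formalIndex W p • padicPointOf W p ι P) /
        (formalIndex W p : ℚ_[p])) ^ 2 ≠ 0 := by
    rw [← hu']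
    exact PadicInt.coe_ne_zero.2 hG0
  have hval := congrArg Padic.valuation hu'
  rw [PadicInt.valuation_coe, valuation_unit_mul_bdpShape u' Dt.c (W.frobeniusTrace p) _ _ hrhs]
    at hval
  rw [hval, padicLogOrd]

/-- **The pinned composite in the packaged currency** `AcSelmer.XAc.HasCharValuationAt … n ∧ n = 2·(ord_p(1
− a_p + p) − 1 + ord_p log_{ω_E} P_K) − 2·ord_p c_E` — pinned twin of
`hasCharValuationAt_of_heegnerDivisibility` (the body of the cells' `X11b.IMCWaldspurgerOnTreeGoodAt` up
to the Manin term, fed by published facts PLUS the PINNED Howard-side containment).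
[cite: YanZhu2024MainConjNonCM, Thm. 5.7 (1) and Thm. 5.9 (arXiv:2412.20078v4 l.1217–1223, l.1283–1293)]
[cite: BurungaleCastellaSkinner2025, Prop. 4.2.2 (p. 9)] [cite: CastellaGrossiLeeSkinner2022, Thm. 5.1.3]
[cite: Castella2018, §5 (eq:IMC+BDP) (arXiv:1704.06608 p. 12) (the same shape at `p ∣ N`)]
[cite: BurungaleCastellaKim2021, Remark 1.2 (arXiv:1908.09512v2 TeX l.192–195) (the pin)] -/
theorem hasCharValuationAt_of_pinnedHeegnerDivisibility
    (h : thm57_thm59_bcs422_cgls513_generator_constantCoeff_of_pinnedHeegnerDivisibility)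
    (hp : 3 ≤ p) (hord : GoodOrd W p)
    (K : Type) [Field K] [NumberField K] (hK : IsImaginaryQuadratic K)
    (hHN : SatisfiesHeegnerHypothesis (W.conductorNorm ℤ) K) (hHp : SatisfiesHeegnerHypothesis p K)
    (hodd : Odd (NumberField.discr K)) (h3 : NumberField.discr K ≠ -3)
    (hirrK : (W.baseChange K).HasIrreducibleModPGaloisRep p) (hhK : ¬ p ∣ NumberField.classNumber K)
    (ι : K →+* ℚ_[p]) (v vbar : HeightOneSpectrum (𝓞 K))
    (hv : ∀ x : 𝓞 K, x ∈ v.asIdeal ↔ ‖ι (x : K)‖ < 1)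
    (hvbar : ((p : ℕ) : 𝓞 K) ∈ vbar.asIdeal) (hne : vbar ≠ v)
    (κ : ZpExtension K p) (hκ : κ.IsAnticyclotomic)
    (γ : absoluteGaloisGroup K) [Fact (κ.IsTopGenerator γ)]
    {N : ℕ} [NeZero N] (Dt : ModularParametrizationData W N)
    (H : HeegnerDatum N (NumberField.discr K)) (ιC : K →+* ℂ) (P : (W.baseChange K).toAffine.Point)
    (hP : WeierstrassCurve.Affine.Point.map ιC.toRatAlgHom P = heegnerPointComplex Dt H)
    (hHow : ∃ (jbar : AlgebraicClosure K →+* ℂ) (D : (W.baseChange K).LambdaAdicSelmerData κ γ)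
      (F : HeegnerFamily N W K κ jbar) (X : (W.baseChange K).SelmerDualData κ γ),
      ¬ (p : ℤ) ∣ F.Dt.c ∧
      heegnerCharIdeal D F ^ 2 ≤
        Module.charIdeal (IwasawaAlgebra p) (Submodule.torsion (IwasawaAlgebra p) X.X))
    (G : IwasawaAlgebra p) (hG : AcSelmer.XAc.charIdeal (W.baseChange K) p κ vbar ∅ γ = Ideal.span {G})
    (hG0 : PowerSeries.constantCoeff G ≠ 0) :
    ∃ n : ℕ, AcSelmer.XAc.HasCharValuationAt (W.baseChange K) p κ vbar ∅ γ n ∧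
      (n : ℤ) = 2 * ((padicValInt p (1 - W.frobeniusTrace p + p) : ℤ) - 1 + padicLogOrd W p ι P) -
        2 * (padicValInt p Dt.c : ℤ) := by
  obtain ⟨htors, -⟩ := h W p hp hord K hK hHN hHp hodd h3 hirrK hhK ι v vbar hv hvbar hne κ hκ γ N
    Dt H ιC P hP hHow
  exact ⟨(PowerSeries.constantCoeff G).valuation,
    AcSelmer.XAc.hasCharValuationAt_of_eq htors hG hG0 rfl,
    valuation_generator_constantCoeff_of_pinnedHeegnerDivisibility h hp hord K hK hHN hHp hodd h3
      hirrK hhK ι v vbar hv hvbar hne κ hκ γ Dt H ιC P hP hHow G hG hG0⟩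

/-- **The X9/X10b consumer edge, pinned: the composite fed by Mastella–Zerman's record at a family of
`p`-adic-unit Manin constant.** Granted the pinned fact AND
`MastellaZerman2026.cor46_howardDivisibility_of_scalarImage`, for `(E, K, p)` meeting both binder lists
and ANY data `(jbar, D, F, X)` at the parametrisation level `N` with `¬ (p : ℤ) ∣ F.Dt.c` (e.g. `F`
tied to the frame's datum `Dt` by `exists_heegnerFamily_Dt_eq`, with the frame's `¬ (p : ℤ) ∣ Dt.c`),
the INTEGRAL identity at `𝟙` holds: `𝒳_{𝓕_Gr}` torsion, `Char = (F)`, `F(0) = u · c_E⁻² (1 − a_p p⁻¹ +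
p⁻¹)² log_{ω_E}(P_K)²`, `u ∈ ℤ_p^×` — at `p = 3, 5, 7` alike, with NO surjectivity anywhere.
Bookkeeping only. [cite: MastellaZerman2026, Cor. 4.6 (arXiv:2505.08710)]
[cite: YanZhu2024MainConjNonCM, Thm. 5.7 (1) and Thm. 5.9] [cite: BurungaleCastellaSkinner2025, Prop. 4.2.2]
[cite: CastellaGrossiLeeSkinner2022, Thm. 5.1.3]
[cite: BurungaleCastellaKim2021, Remark 1.2 (arXiv:1908.09512v2 TeX l.192–195) (the pin)] -/
theorem generator_constantCoeff_of_cor46_pinned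
    (h : thm57_thm59_bcs422_cgls513_generator_constantCoeff_of_pinnedHeegnerDivisibility)
    (h46 : MastellaZerman2026.cor46_howardDivisibility_of_scalarImage.{0})
    (hp : 3 ≤ p) (hord : GoodOrd W p)
    (K : Type) [Field K] [NumberField K] (hK : IsImaginaryQuadratic K)
    (hHN : SatisfiesHeegnerHypothesis (W.conductorNorm ℤ) K) (hHp : SatisfiesHeegnerHypothesis p K)
    (hodd : Odd (NumberField.discr K)) (h3 : NumberField.discr K ≠ -3)
    (hirrK : (W.baseChange K).HasIrreducibleModPGaloisRep p)
    (ι : K →+* ℚ_[p]) (v vbar : HeightOneSpectrum (𝓞 K))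
    (hv : ∀ x : 𝓞 K, x ∈ v.asIdeal ↔ ‖ι (x : K)‖ < 1)
    (hvbar : ((p : ℕ) : 𝓞 K) ∈ vbar.asIdeal) (hne : vbar ≠ v)
    (κ : ZpExtension K p) (γ : absoluteGaloisGroup K) [Fact (κ.IsTopGenerator γ)]
    {N : ℕ} [NeZero N] (hypMZ : MastellaZerman2026.Hypotheses N W K p κ γ)
    (Dt : ModularParametrizationData W N)
    (H : HeegnerDatum N (NumberField.discr K)) (ιC : K →+* ℂ) (P : (W.baseChange K).toAffine.Point)
    (hP : WeierstrassCurve.Affine.Point.map ιC.toRatAlgHom P = heegnerPointComplex Dt H)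
    (jbar : AlgebraicClosure K →+* ℂ) (D : (W.baseChange K).LambdaAdicSelmerData κ γ)
    (F : HeegnerFamily N W K κ jbar) (X : (W.baseChange K).SelmerDualData κ γ)
    (hc : ¬ (p : ℤ) ∣ F.Dt.c) :
    Module.IsTorsion (IwasawaAlgebra p) (AcSelmer.XAc (W.baseChange K) p κ vbar ∅ γ) ∧
      ∃ F : IwasawaAlgebra p,
        AcSelmer.XAc.charIdeal (W.baseChange K) p κ vbar ∅ γ = Ideal.span {F} ∧
        ∃ u : ℤ_[p]ˣ,
          ((PowerSeries.constantCoeff F : ℤ_[p]) : ℚ_[p]) =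
            ((u : ℤ_[p]) : ℚ_[p]) * ((Dt.c : ℚ_[p])⁻¹) ^ 2 *
              (1 - (W.frobeniusTrace p : ℚ_[p]) * (p : ℚ_[p])⁻¹ + (p : ℚ_[p])⁻¹) ^ 2 *
              ((W.baseChange ℚ_[p]).padicLogPoint (formalIndex W p • padicPointOf W p ι P) /
                (formalIndex W p : ℚ_[p])) ^ 2 :=
  h W p hp hord K hK hHN hHp hodd h3 hirrK hypMZ.not_dvd_classNumber ι v vbar hv hvbar hne κ
    hypMZ.anticyclotomic γ N Dt H ιC P hP (pinnedHeegnerContainment_of_cor46 h46 hypMZ jbar D F X hc)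

end ConsumersPinned

end Literature.NumberTheory.EllipticCurves.YanZhu2026

end
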